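import Literature.Computability.AlgebraicComplexity.LaurentPolyOrder
import Literature.Computability.AlgebraicComplexity.StandardFamilies
import Literature.LinearAlgebra.Matrix.PfaffianCongruence
import HarnessLib

/-!
# Andrews–Forbes 2022 §3.2–§3.3, §4, §5 — hardness of determinantal and Pfaffian ideals,
# partial derivatives in determinantal ideals (val-lit t24; source `paper:arxiv-2112.00792`;
# bib `AndrewsForbes2022`)

Typed literature (D-0014/D-0064 statement file): the numbered statements of

* R. Andrews, M. A. Forbes, *Ideals, determinants, and straightening: proving and using lower
  bounds for polynomial ideals*, STOC 2022 = arXiv:2112.00792 [`AndrewsForbes2022`],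
  §3.2 (Lemma 3.6, Lemma 3.7, **Theorem 3.8**), §3.3 (Corollaries 3.9, 3.10, Remark 3.11),
  §4 (Proposition 4.2, Lemma 4.3, **Theorem 4.4**, Corollary 4.5), §5 (Proposition 5.3,
  **Theorem 5.4**, Remark 5.5), with the §2 preliminaries these statements invoke
  (Def. 2.1 / Lemma 2.3 reparametrisation `ε ↦ ε^N`, Def. 2.19 Hasse derivatives and the spaces
  `∂_{<∞}`, `∂_{≤d}`, Def. 2.23 general bideterminants `(S | T)` and their width, §2.6 Pfaffians,
  the ideal `I^Pf_{2n,2r}` and the standard monomials `[K_σ]`),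

stated in the vocabulary the tree already has for this paper: `detIdeal F n m r` (`I^det_{n,m,r}`),
`leadingMinor`, `kBideterminant` (`(K_σ | K_σ)`), `IsBigOEps` (`BideterminantReduction.lean`, where
**Prop. 3.5 is vendored and PROVED**: `AndrewsForbes2022_prop_3_5_holds`), `PolyOrdGE k p` (every
`F((ε))`-coefficient of `p` is `O(ε^k)`, `LaurentPolyOrder.lean`), `detPoly`, `immMatrix`
(`StandardFamilies.lean`). Locators `pNNNN.txt:Lnn` refer to the chunk files of
`lit read paper:arxiv-2112.00792`; printed numbers are those of arXiv v2 = STOC.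

## How the circuit statements are rendered (no circuit model is needed)

* **Layered ABPs** (Lemma 3.6/3.7, Thm. 3.8: "`g` can be computed by a layered algebraic
  branching program on (at most) `m` vertices", edge labels affine-linear forms, p0022:L28,
  p0023:L13 "`ℓ_e(y) = α₀ + Σ αᵢ yᵢ`"): `LayeredABPComputes m g` — at most `m` vertices `Fin k`,
  `k ≤ m`, a layer function, an adjacency matrix `N` of polynomials of total degree `≤ 1` with
  `N u v ≠ 0 → layer v = layer u + 1`, source `s`, sink `t`, and `g = (N^{layer t - layer s}) s t`
  (= the sum over `s–t` paths of the products of the labels; in a layered graph every `s–t` path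
  has this length). Vertices not on an `s–t` path are allowed, exactly as the paper allows
  "adding isolated vertices" (p0023:L71) to reach exactly `r` vertices.
* **"in the border of layered ABPs with at most `r` vertices"** (Thm. 3.8 hypothesis) is rendered
  as the paper USES it (proof, p0023:L61): some `g̃ ∈ F[ε][y]`, computed by a layered ABP over
  `F[ε]` on at most `r` vertices, has `g̃ = g + O(ε)` (`InLayeredABPBorder r g`). Exact
  computation over `F` is the case `g̃ = g` (`InLayeredABPBorder.of_computes`).
* **The depth-three single-oracle circuit** of Thm. 3.8/4.4 and Cors. 3.9/3.10/4.5 ("`nm` addition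
  gates at the bottom layer, a single `h`-oracle gate in the middle layer, and a single addition
  gate at the top layer", defined over `F(ε)`, computing `g + O(ε)`) is, written out, the
  identity `u · h^{(N)}(a(y)) + v = g(y) + O(ε)` coefficientwise in `F((ε))[y]`, where the
  bottom gates are affine-linear forms `a_{i,j}(y)` over `F(ε)`, the top gate is the affine map
  `w ↦ u w + v` (`u, v ∈ F(ε)`), and `h^{(N)}(X, ε) = h(X, ε^N)`: by the paper's Lemma 2.3
  (p0012:L24–L45, from [Bürgisser 2004] = Lemma 2.2) an `h`-oracle circuit for an approximate
  oracle `h = f + O(ε)` is a circuit "with `h(x, ε^N)`-oracle gates" for `N` large, and the proofs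
  of Thms. 3.8/4.4 begin with exactly this reduction (p0023:L60, p0027:L99). This is
  `DepthThreeOracleComputes h g` (`epsPow F N` is `ε ↦ ε^{N+1}` on `F((ε))`).
* **Hasse derivatives** (Def. 2.13, Lemma 2.14): `mvHasseDeriv a f`, defined by the monomial
  formula of Lemma 2.14 (`∂/∂x^a (x^b) = ∏ binom(bᵢ,aᵢ) x^{b-a}`); `partialSpace f = ∂_{<∞}(f)`,
  `partialSpaceLE d f = ∂_{≤d}(f)` (Def. 2.19) as `F`-subspaces; dimensions are `Module.finrank`.
* **Pfaffians** (§2.6): Mathlib has no Pfaffian; the tree has one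
  (`Literature.LinearAlgebra.Matrix.pfaffian`, Kustin–Ulrich first-row expansion, size implicit; and
  the perfect-matching form `Literature.Combinatorics.Enumerative.pfaffian`, proved equal to it);
  `pfaffian k A` below is the SAME function with the size `k` explicit (needed to write `Pf_s`,
  `Pf_{2r}`, `Pf_{2t}` uniformly in `s, r, t`), see the bridge `pfaffian_eq_matrixPfaffian`
  (so Cayley's `det = Pf²`, `pfaffian_bipartiteDouble` = Lemma 2.28, congruence = Lemma 2.27 are
  available from those files); it is the expansion along the first
  row, `Pf(A) = Σ_{j ≥ 2} (-1)^j a_{1j} Pf(A_{1̂ĵ,1̂ĵ})` (so `Pf` of odd size is `0` and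
  `Pf ((0 a),(-a 0)) = a`), which agrees with the printed `(1/(2^n n!)) Σ_σ sgn σ ∏ x_{σ(2i-1)σ(2i)}`
  on skew-symmetric matrices and is characteristic-free ("the Pfaffian is well-defined even over
  fields of small characteristic", p0016:L22). `skewX k R` is the generic skew-symmetric `k × k`
  matrix on the variables `x_{i,j}`, `i < j` (`SkewVarIdx k`); `pfaffIdeal F n r = I^Pf_{2n,2r}`;
  `kPfaffMonomial F k σ = [K_σ](X) = ∏ᵢ Pf(X_{[σᵢ],[σᵢ]})` (§4.1 with Def. 2.29).

## What is a fact, what is proved, what is NOT here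

Published-but-unproved-in-tree results are named facts `def AndrewsForbes2022_… : Prop` (D-0014):
Lemma 3.6 [Valiant 1979], Lemma 3.7, Thm. 3.8 (char `0`; the char-`p` bullet separately),
Cor. 3.9 [with MV97], Cor. 3.10, Prop. 4.2, Lemma 4.3, Thm. 4.4 (+ char `p`), Cor. 4.5 [with MSV04],
Prop. 5.3 (+ char-`0` clause), Thm. 5.4 (+ char-`0` clause, + the printed value
`dim ∂_{<∞}(det_r) = binom(2r, r)`). Proved here: unfolding/API lemmas (`pfaffian_two`,
`mvHasseDeriv_monomial` = Lemma 2.14, `InLayeredABPBorder.of_computes`, …). NOT here: Lemma 3.4 /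
Lemma 4.1 (the leading-coefficient lemmas under `X ↦ M X N`, resp. `X ↦ M X Mᵀ` — steps of the
proofs of Props. 3.5/4.2, not vendored separately, as `BideterminantReduction.lean` did for 3.4),
Claim 3.2 / Lemmas 3.1, 3.3 [CEP80] (tableau combinatorics inside those proofs), Lemmas 5.1–5.2
(steps of Prop. 5.3), the straightening laws Thms. 2.24–2.25/2.30 and Cors. 2.26/2.31, and §6–§8
(file `AndrewsForbes2022Applications.lean`). Errata recorded: Thm. 4.4 bullet 1 says "`nm` addition
gates" for a `2n × 2n` skew-symmetric `X` (read: one gate per entry of `X`, `4n²` as in Cor. 4.5);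
Cor. 4.5 writes `Pf_t` for the Pfaffian hit with `t ≤ O(r^{1/3})` (rendered: the `2t × 2t` Pfaffian,
`c t³ ≤ r`). Honest framing: typed literature for the val-lit NP corpus (V4, read-once /
coefficient-placed determinants as distinguishers); VP ≠ VNP is NOT proved and nothing here is
progress on it.

## References

* [AndrewsForbes2022] R. Andrews, M. A. Forbes, STOC 2022, doi:10.1145/3519935.3520025,
  arXiv:2112.00792 — §2.1 Def. 2.1, Lemmas 2.2–2.3; §2.4 Def. 2.13, Lemma 2.14, Def. 2.19, Lemma
  2.20; §2.5 Def. 2.23; §2.6 Lemmas 2.27–2.28, Def. 2.29, Thm. 2.30, Cor. 2.31; §3.2 Lemmas 3.6–3.7,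
  Thm. 3.8; §3.3 Cors. 3.9–3.10, Rem. 3.11; §4 Lemma 4.1, Prop. 4.2, Lemma 4.3, Thm. 4.4, Cor. 4.5;
  §5 Lemmas 5.1–5.2, Prop. 5.3, Thm. 5.4, Rem. 5.5.
* [Valiant1979] L. G. Valiant, Completeness classes in algebra, STOC 1979, Thm. 1 (behind Lemma 3.6).
* [MahajanVinay1997] M. Mahajan, V. Vinay, Determinant: combinatorics, algorithms, and complexity,
  1997, Thm. 2 (the `O(t³)`-vertex layered ABP for `det_t` behind Cor. 3.9); Mahajan–Subramanya–Vinay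
  2004, Thm. 12 (the Pfaffian ABP behind Cor. 4.5), both cited through the paper.
-/

noncomputable section

open MvPolynomial Matrix
open scoped RatFunc

namespace Literature.Computability.AlgebraicComplexity

universe u v w

/-! ### §2.1 (Def. 2.1, Lemmas 2.2–2.3): the reparametrisation `ε ↦ ε^N` of `F((ε))` -/

section EpsPow

variable (F : Type u) [Field F]

/-- Multiplication by `N + 1` on the exponent group `ℤ` (cf. the tree's `doubleHom` for `N + 1 = 2`).
[folklore] -/
def epsPowHom (N : ℕ) : ℤ →+ ℤ where
  toFun n := ((N : ℤ) + 1) * n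
  map_zero' := by simp
  map_add' a b := by ring

/-- **`ε ↦ ε^{N+1}`** on `F((ε))`: the ring endomorphism reindexing a Laurent series along
`n ↦ (N+1) n` — the substitution "`ε ↦ ε^N`" of Lemmas 2.2–2.3 (p0012:L6–L45: an approximate
oracle `h(x, δ) = g(x) + O(δ)` is used through "`h(x, ε^N)`-oracle gates" for `N` large) and of the
proofs of Thms. 3.8/4.4 ("Performing the substitution `ε ↦ ε^N`, `δ ↦ ε`", p0024:L27).
`epsPow F 0` is the identity, `epsPow F 1` is the tree's `sqEps`. [cite: AndrewsForbes2022, Lemma 2.3] -/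
def epsPow (N : ℕ) : LaurentSeries F →+* LaurentSeries F :=
  HahnSeries.embDomainRingHom (epsPowHom N)
    (fun a b h => by
      have hN : (0 : ℤ) < (N : ℤ) + 1 := by positivity
      have h' : ((N : ℤ) + 1) * a = ((N : ℤ) + 1) * b := h
      exact mul_left_cancel₀ hN.ne' h')
    (fun a b => by
      have hN : (0 : ℤ) < (N : ℤ) + 1 := by positivity
      show ((N : ℤ) + 1) * a ≤ ((N : ℤ) + 1) * b ↔ a ≤ b
      exact ⟨fun h => le_of_mul_le_mul_left h hN, fun h => mul_le_mul_of_nonneg_left h hN.le⟩)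

variable {F}

/-- `epsPow N` fixes constants (the substitution `ε ↦ ε^N` is `F`-linear). [cite: AndrewsForbes2022, Lemma 2.3] -/
@[simp] theorem epsPow_C (N : ℕ) (a : F) : epsPow F N (HahnSeries.C a) = HahnSeries.C a :=
  HahnSeries.embDomainRingHom_C

/-- `epsPow N (a ε^n) = a ε^{(N+1) n}`: it IS the substitution `ε ↦ ε^{N+1}`. [cite: AndrewsForbes2022, Lemma 2.3] -/
@[simp] theorem epsPow_single (N : ℕ) (n : ℤ) (a : F) :
    epsPow F N (HahnSeries.single n a) = HahnSeries.single (((N : ℤ) + 1) * n) a := by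
  rw [epsPow, HahnSeries.embDomainRingHom_apply, HahnSeries.embDomain_single]
  rfl

end EpsPow

/-! ### §3.2: layered algebraic branching programs (the hypothesis of Lemmas 3.6–3.7, Thm. 3.8) -/

section ABP

variable {R : Type u} [CommSemiring R] {ι : Type v}

/-- **`g` is computed by a layered algebraic branching program on at most `m` vertices**
(Andrews–Forbes §3.2, Lemmas 3.6/3.7/Thm. 3.8; the paper assumes "familiarity with the basic
notion", §2 p0011:L24, and uses: a layered directed graph — all edges go from a layer to the next,
so "every `s–t` path has the same length" (p0022:L59) — with source `s`, sink `t`, edges labelled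
by affine-linear forms "`ℓ_e(y) = α₀ + Σᵢ αᵢ yᵢ`" (p0023:L13), computing the sum over `s–t` paths of
the products of the labels; isolated/dummy vertices are allowed, p0023:L71, p0027:L112).
Rendering: vertex set `Fin k` with `k ≤ m`, `layer : Fin k → ℕ`, adjacency matrix `N` of labels of
total degree `≤ 1` (`N u v = 0` means no edge) respecting the layering, and the computed polynomial
as the matrix-power entry `(N ^ (layer t - layer s)) s t` (which is the path sum, all `s–t` paths
having length `layer t - layer s`). Over any commutative semiring of coefficients (the paper applies
Lemma 3.6 over `F[ε]`, p0023:L73). [cite: AndrewsForbes2022, §3.2 (Lemma 3.6, Thm. 3.8)] -/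
def LayeredABPComputes (m : ℕ) (g : MvPolynomial ι R) : Prop :=
  ∃ (k : ℕ) (_ : k ≤ m) (layer : Fin k → ℕ) (s t : Fin k) (N : Matrix (Fin k) (Fin k) (MvPolynomial ι R)),
    (∀ u v, N u v ≠ 0 → layer v = layer u + 1) ∧ (∀ u v, (N u v).totalDegree ≤ 1) ∧
      (N ^ (layer t - layer s)) s t = g

/-- Monotonicity in the vertex budget ("we can obtain a layered ABP on exactly `r` vertices … by
adding isolated vertices", p0023:L71). [cite: AndrewsForbes2022, §3.2 (proof of Thm. 3.8)] -/
theorem LayeredABPComputes.mono {m m' : ℕ} (h : m ≤ m') {g : MvPolynomial ι R}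
    (hg : LayeredABPComputes m g) : LayeredABPComputes m' g := by
  obtain ⟨k, hk, layer, s, t, N, h1, h2, h3⟩ := hg
  exact ⟨k, hk.trans h, layer, s, t, N, h1, h2, h3⟩

/-- A single variable `y_i` is computed by the two-vertex ABP `s —y_i→ t` (non-vacuity of the
notion; the base case of the ABPs of §3.2). [cite: AndrewsForbes2022, §3.2 (Lemma 3.7, proof)] -/
theorem layeredABPComputes_X [DecidableEq ι] (i : ι) {m : ℕ} (hm : 2 ≤ m) :
    LayeredABPComputes m (X i : MvPolynomial ι R) := by
  classical
  refine ⟨2, hm, fun v => (v : ℕ), 0, 1, Matrix.of fun u v => if u = 0 ∧ v = 1 then X i else 0,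
    ?_, ?_, ?_⟩
  · intro u v huv
    simp only [Matrix.of_apply, ne_eq, ite_eq_right_iff, Classical.not_imp] at huv
    obtain ⟨⟨rfl, rfl⟩, -⟩ := huv
    simp
  · intro u v
    simp only [Matrix.of_apply]
    split_ifs
    · rcases subsingleton_or_nontrivial R with hR | hR
      · simp [Subsingleton.elim (X i : MvPolynomial ι R) 0]
      · simp [totalDegree_X]
    · simp
  · simp [Matrix.of_apply]

/-- Total degree does not increase under a change of coefficients. [folklore] -/
private theorem totalDegree_map_le {S : Type w} [CommSemiring S] (φ : R →+* S) (p : MvPolynomial ι R) :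
    (MvPolynomial.map φ p).totalDegree ≤ p.totalDegree :=
  Finset.sup_mono (support_map_subset φ p)

/-- Changing coefficients along a ring hom preserves layered-ABP computability (relabel every
edge; used for `F ⊆ F[ε]`, the exact case of the border hypothesis of Thm. 3.8).
[cite: AndrewsForbes2022, Thm. 3.8 (hypothesis)] -/
theorem LayeredABPComputes.map {S : Type w} [CommSemiring S] (φ : R →+* S) {m : ℕ}
    {g : MvPolynomial ι R} (hg : LayeredABPComputes m g) :
    LayeredABPComputes m (MvPolynomial.map φ g) := by
  obtain ⟨k, hk, layer, s, t, N, h1, h2, h3⟩ := hg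
  refine ⟨k, hk, layer, s, t, N.map (MvPolynomial.map φ), ?_, ?_, ?_⟩
  · intro u v huv
    refine h1 u v fun h0 => huv ?_
    simp [h0]
  · intro u v
    exact (totalDegree_map_le φ (N u v)).trans (h2 u v)
  · rw [← h3, ← RingHom.mapMatrix_apply, ← map_pow, RingHom.mapMatrix_apply, Matrix.map_apply]

end ABP

section ABPBorder

variable {F : Type u} [Field F] {ι : Type v}

/-- **`g` lies in the border of layered ABPs with at most `r` vertices**, in the form the proof of
Thm. 3.8 uses (p0023:L61): "there is a polynomial `g̃(y, ε) ∈ F[ε][y]` such that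
`g̃(y, ε) = g(y) + O(ε)` and `g̃` can be computed by a layered algebraic branching program on at
most `r` vertices" (over `F[ε]`); `g̃ = g + O(ε)` coefficientwise is `g̃|_{ε = 0} = g`.
[cite: AndrewsForbes2022, Thm. 3.8 (hypothesis, proof p. 23)] -/
def InLayeredABPBorder (r : ℕ) (g : MvPolynomial ι F) : Prop :=
  ∃ g' : MvPolynomial ι (Polynomial F), LayeredABPComputes r g' ∧
    MvPolynomial.map (Polynomial.constantCoeff : Polynomial F →+* F) g' = g

/-- Exact computation is border computation (`g̃ = g`, constant in `ε`; how Cors. 3.9/3.10 use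
Thm. 3.8). [cite: AndrewsForbes2022, Thm. 3.8 (hypothesis) and Cor. 3.9 (proof)] -/
theorem InLayeredABPBorder.of_computes {r : ℕ} {g : MvPolynomial ι F}
    (hg : LayeredABPComputes r g) : InLayeredABPBorder r g := by
  refine ⟨MvPolynomial.map (Polynomial.C : F →+* Polynomial F) g, hg.map _, ?_⟩
  rw [MvPolynomial.map_map]
  have : (Polynomial.constantCoeff : Polynomial F →+* F).comp Polynomial.C = RingHom.id F :=
    RingHom.ext fun a => by simp
  rw [this, MvPolynomial.map_id]

end ABPBorder

/-! ### Thm. 3.8, bullet 1: the depth-three single-oracle circuit, written out -/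

section DepthThree

variable {F : Type u} [Field F] {σ : Type v} {ι : Type w}

/-- **The depth-three `h`-oracle circuit of Thm. 3.8 computes `g + O(ε)`** ("`Φ` has `nm` addition
gates at the bottom layer, a single `h`-oracle gate in the middle layer, and a single addition gate
at the top layer", "defined over `F(ε)`", p0023:L53–L57), written out: there are affine-linear
forms `a_x(y) ∈ F(ε)[y]` (one bottom gate per variable `x` of `h`), scalars `u, v ∈ F(ε)` (the top
gate `w ↦ u w + v`) and `N` (the oracle evaluates `h(·, ε^{N+1})`, the paper's Lemma 2.3 convention
for approximate oracles, p0012:L24–L45 and p0023:L60) with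
`u · h(a(y), ε^{N+1}) + v - g(y) = O(ε)` coefficientwise in `F((ε))[y]` (`PolyOrdGE 1`).
Here `h ∈ F((ε))[X_σ]` and the target `g ∈ F((ε))[y_ι]` (for Thm. 3.8: `g ∈ F[y]` base-changed).
[cite: AndrewsForbes2022, Thm. 3.8 (first bullet) with Lemma 2.3] -/
def DepthThreeOracleComputes (h : MvPolynomial σ (LaurentSeries F))
    (g : MvPolynomial ι (LaurentSeries F)) : Prop :=
  ∃ (N : ℕ) (a : σ → MvPolynomial ι (RatFunc F)) (u v : RatFunc F),
    (∀ x, (a x).totalDegree ≤ 1) ∧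
      PolyOrdGE 1
        (MvPolynomial.C (algebraMap (RatFunc F) (LaurentSeries F) u) *
            MvPolynomial.aeval
              (fun x => MvPolynomial.map (algebraMap (RatFunc F) (LaurentSeries F)) (a x))
              (MvPolynomial.map (epsPow F N) h) +
          MvPolynomial.C (algebraMap (RatFunc F) (LaurentSeries F) v) - g)

end DepthThree

/-! ### §3.2: Lemma 3.6 [Valiant 1979], Lemma 3.7, Theorem 3.8 -/

section HardnessDet

/-- **Andrews–Forbes 2022, Lemma 3.6** (a small modification of [Valiant 1979, Thm. 1], p0022:L27):
if `g` is computed by a layered ABP on `m` vertices, there is an `m × m` matrix `A` whose entries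
are (affine-)linear polynomials with `det A = 1 + g` and all proper leading principal minors
`det A_{[k],[k]} = 1`, `k ∈ [m-1]` (here `k < m`, the case `k = 0` being the empty determinant).
Stated over any commutative ring of coefficients: the paper states it over `F` and applies it over
`F[ε]` (p0023:L73, "`A(y, z) ∈ F[ε][y, z]^{r × r}` obtained by applying Lemma 3.6"); the printed
proof (cycle covers of the ABP graph with a back edge and self-loops) is verbatim over any
commutative ring. With at most `m` vertices one pads `A` by an identity block in FRONT
(`I ⊕ A`), which keeps both properties. [cite: AndrewsForbes2022, Lemma 3.6] -/
def AndrewsForbes2022_lemma_3_6 : Prop :=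
  ∀ (R : Type) [CommRing R] (ι : Type) (m : ℕ) (g : MvPolynomial ι R), LayeredABPComputes m g →
    ∃ A : Matrix (Fin m) (Fin m) (MvPolynomial ι R),
      (∀ i j, (A i j).totalDegree ≤ 1) ∧ A.det = 1 + g ∧
        ∀ (k : ℕ) (hk : k < m), (A.submatrix (Fin.castLE hk.le) (Fin.castLE hk.le)).det = 1

/-- **Andrews–Forbes 2022, Lemma 3.7** (homogenisation keeps layered-ABP size, p0023:L6): if `g(y)`
is computed by a layered ABP on `m` vertices and `z` is a new variable, there is a HOMOGENEOUS
`ĝ(y, z)` computed by a layered ABP on `m` vertices with `ĝ(y, 1) = g(y)` (the proof gives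
`ĝ = z^d g(y/z)` for some `d ≥ deg g`, p0023:L4). The new variable is `none : Option ι`.
[cite: AndrewsForbes2022, Lemma 3.7] -/
def AndrewsForbes2022_lemma_3_7 : Prop :=
  ∀ (R : Type) [CommRing R] (ι : Type) (m : ℕ) (g : MvPolynomial ι R), LayeredABPComputes m g →
    ∃ (ĝ : MvPolynomial (Option ι) R) (d : ℕ), ĝ.IsHomogeneous d ∧ LayeredABPComputes m ĝ ∧
      MvPolynomial.aeval (fun o : Option ι => o.elim (1 : MvPolynomial ι R) X) ĝ = g

/-- **Andrews–Forbes 2022, Theorem 3.8** (every nonzero `f ∈ I^det_{n,m,r}` is as border-hard as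
any `r`-vertex layered ABP, for depth-three oracle reductions; characteristic zero bullet).
Let `f(X) ∈ I^det_{n,m,r}` be nonzero, `h(X, ε) ∈ F⟦ε⟧[X]` any polynomial with `h = f + O(ε)`, and
`g(y) ∈ F[y]` in the border of layered ABPs with at most `r` vertices. Then there is a depth-three
`h`-oracle circuit `Φ` over `F(ε)` — `nm` addition gates at the bottom, one `h`-oracle gate, one
addition gate at the top — which, if `char F = 0`, computes `g(y) + O(ε)` (p0023:L48–L57).
Rendered with `detIdeal`, `PolyOrdGE`, `InLayeredABPBorder`, `DepthThreeOracleComputes` (module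
docstring); `h ∈ F⟦ε⟧[X]` follows from `h - f = O(ε)`; the variables `y` of `g` are indexed by
an arbitrary type `ι` (the paper's `y = (y_1, …, y_k)`; only the finitely many variables of the ABP
matter). LOAD-BEARING for GAP row N7. [cite: AndrewsForbes2022, Thm. 3.8] -/
def AndrewsForbes2022_thm_3_8 : Prop :=
  ∀ (F : Type) [Field F] [CharZero F] (n m r : ℕ) (f : MvPolynomial (Fin n × Fin m) F),
    f ∈ detIdeal F n m r → f ≠ 0 →
  ∀ h : MvPolynomial (Fin n × Fin m) (LaurentSeries F),
    PolyOrdGE 1 (h - MvPolynomial.map (algebraMap F (LaurentSeries F)) f) →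
  ∀ (ι : Type) (g : MvPolynomial ι F), InLayeredABPBorder r g →
    DepthThreeOracleComputes h (MvPolynomial.map (algebraMap F (LaurentSeries F)) g)

/-- **Andrews–Forbes 2022, Theorem 3.8, positive-characteristic bullet**: with the data of
`AndrewsForbes2022_thm_3_8` but `char F = p > 0`, the circuit computes `g(y)^{p^k} + O(ε)` for some
`k ∈ ℕ` (p0023:L57; cf. Remark 3.11, p0024:L94, on why `p`-th powers appear).
[cite: AndrewsForbes2022, Thm. 3.8 (third bullet)] -/
def AndrewsForbes2022_thm_3_8_posChar : Prop :=
  ∀ (p : ℕ) [Fact p.Prime] (F : Type) [Field F] [CharP F p] (n m r : ℕ)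
    (f : MvPolynomial (Fin n × Fin m) F), f ∈ detIdeal F n m r → f ≠ 0 →
  ∀ h : MvPolynomial (Fin n × Fin m) (LaurentSeries F),
    PolyOrdGE 1 (h - MvPolynomial.map (algebraMap F (LaurentSeries F)) f) →
  ∀ (ι : Type) (g : MvPolynomial ι F), InLayeredABPBorder r g →
    ∃ e : ℕ, DepthThreeOracleComputes h (MvPolynomial.map (algebraMap F (LaurentSeries F)) (g ^ p ^ e))

/-! ### §3.3: Corollaries 3.9 (determinant) and 3.10 (iterated matrix multiplication) -/

/-- **Andrews–Forbes 2022, Corollary 3.9** (char `0` bullet; p0024:L60): for nonzero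
`f ∈ I^det_{n,m,r}`, `h = f + O(ε)` and `t ≤ O(r^{1/3})`, a depth-three `h`-oracle circuit of the
shape of Thm. 3.8 computes `det_t(Y) + O(ε)`. "`t ≤ O(r^{1/3})`" hides an unnamed absolute
constant: rendered as `∃ c, ∀ t, c · t³ ≤ r → …` (the proof: [MV97, Thm. 2] gives a layered ABP for
`det_t` on `O(t³) ≤ r` vertices, then Thm. 3.8; see `AndrewsForbes2022_cor_3_9_of`). `det_t` is the
tree's `detPoly (Fin t) F`. [cite: AndrewsForbes2022, Cor. 3.9] -/
def AndrewsForbes2022_cor_3_9 : Prop :=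
  ∃ c : ℕ, ∀ (F : Type) [Field F] [CharZero F] (n m r : ℕ) (f : MvPolynomial (Fin n × Fin m) F),
    f ∈ detIdeal F n m r → f ≠ 0 →
  ∀ h : MvPolynomial (Fin n × Fin m) (LaurentSeries F),
    PolyOrdGE 1 (h - MvPolynomial.map (algebraMap F (LaurentSeries F)) f) →
  ∀ t : ℕ, c * t ^ 3 ≤ r →
    DepthThreeOracleComputes h (MvPolynomial.map (algebraMap F (LaurentSeries F)) (detPoly (Fin t) F))

/-- The proof of Cor. 3.9 as printed, from its two ingredients taken as hypotheses: Thm. 3.8, and a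
layered ABP for `det_t` on `c · t³` vertices for every `t` (the role of [MV97, Thm. 2], p0024:L72).
[cite: AndrewsForbes2022, Cor. 3.9 (proof)] -/
theorem AndrewsForbes2022_cor_3_9_of (h38 : AndrewsForbes2022_thm_3_8) {c : ℕ}
    (hdet : ∀ (F : Type) [Field F] (t : ℕ), LayeredABPComputes (c * t ^ 3) (detPoly (Fin t) F))
    (F : Type) [Field F] [CharZero F] (n m r : ℕ) (f : MvPolynomial (Fin n × Fin m) F)
    (hf : f ∈ detIdeal F n m r) (hf0 : f ≠ 0) (h : MvPolynomial (Fin n × Fin m) (LaurentSeries F))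
    (hh : PolyOrdGE 1 (h - MvPolynomial.map (algebraMap F (LaurentSeries F)) f))
    (t : ℕ) (ht : c * t ^ 3 ≤ r) :
    DepthThreeOracleComputes h
      (MvPolynomial.map (algebraMap F (LaurentSeries F)) (detPoly (Fin t) F)) :=
  h38 F n m r f hf hf0 h hh _ _ (InLayeredABPBorder.of_computes (((hdet F t).mono ht)))

/-- **`IMM_{w,d}`, the `(1,1)` entry of a product of `d` generic `w × w` matrices** (the iterated
matrix multiplication polynomial in the form Cor. 3.10 uses: "computable by a layered algebraic
branching program on `w(d-1) + 2` vertices", p0024:L88 — source, `d - 1` layers of width `w`, sink),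
as the `(0,0)` entry of the tree's `immMatrix (Fin w) d F = X^{(0)} ⋯ X^{(d-1)}` (the tree's
`immPoly` is the TRACE variant of LST21 and needs more vertices). [cite: AndrewsForbes2022, Cor. 3.10] -/
def imm11Poly (w d : ℕ) [NeZero w] (F : Type u) [CommSemiring F] :
    MvPolynomial (Fin d × Fin w × Fin w) F :=
  immMatrix (Fin w) d F 0 0

/-- `IMM_{w,0} = 1` (empty product; the degenerate corner of Cor. 3.10). [cite: AndrewsForbes2022, Cor. 3.10] -/
@[simp] theorem imm11Poly_zero (w : ℕ) [NeZero w] (F : Type u) [CommSemiring F] :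
    imm11Poly w 0 F = 1 := by
  simp [imm11Poly, immMatrix]

/-- **Andrews–Forbes 2022, Corollary 3.10** (char `0` bullet; p0024:L76): for nonzero
`f ∈ I^det_{n,m,r}`, `h = f + O(ε)` and `w, d` with `w(d-1) + 2 ≤ r`, a depth-three `h`-oracle
circuit of the shape of Thm. 3.8 computes `IMM_{w,d}(y) + O(ε)` (`imm11Poly`). (`d - 1` is natural
subtraction, harmless: for `d = 0`, `IMM = 1` is a constant.) [cite: AndrewsForbes2022, Cor. 3.10] -/
def AndrewsForbes2022_cor_3_10 : Prop :=
  ∀ (F : Type) [Field F] [CharZero F] (n m r : ℕ) (f : MvPolynomial (Fin n × Fin m) F),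
    f ∈ detIdeal F n m r → f ≠ 0 →
  ∀ h : MvPolynomial (Fin n × Fin m) (LaurentSeries F),
    PolyOrdGE 1 (h - MvPolynomial.map (algebraMap F (LaurentSeries F)) f) →
  ∀ (w d : ℕ) [NeZero w], w * (d - 1) + 2 ≤ r →
    DepthThreeOracleComputes h (MvPolynomial.map (algebraMap F (LaurentSeries F)) (imm11Poly w d F))

/-- The proof of Cor. 3.10 as printed, from Thm. 3.8 and the layered ABP for `IMM_{w,d}` on
`w(d-1)+2` vertices ("It is clear that …", p0024:L88) taken as hypotheses.
[cite: AndrewsForbes2022, Cor. 3.10 (proof)] -/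
theorem AndrewsForbes2022_cor_3_10_of (h38 : AndrewsForbes2022_thm_3_8)
    (himm : ∀ (F : Type) [Field F] (w d : ℕ) [NeZero w],
      LayeredABPComputes (w * (d - 1) + 2) (imm11Poly w d F)) :
    AndrewsForbes2022_cor_3_10 := by
  intro F _ _ n m r f hf hf0 h hh w d _ hwd
  exact h38 F n m r f hf hf0 h hh _ _ (InLayeredABPBorder.of_computes ((himm F w d).mono hwd))

end HardnessDet

/-! ### §2.6 and §4: Pfaffians, the ideal `I^Pf_{2n,2r}`, the standard monomials `[K_σ]` -/

section Pfaffian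

variable {R : Type u} [CommRing R]

/-- The **Pfaffian** of a `k × k` matrix, by expansion along the first row:
`Pf(A) = Σ_{j=2}^{k} (-1)^j a_{1,j} Pf(A_{1̂ĵ,1̂ĵ})`, `Pf` of the empty matrix `= 1`, of a `1 × 1`
matrix `= 0`. On skew-symmetric matrices of even size `2n` this is the printed
`Pf(X) = (1/(2^n n!)) Σ_{σ ∈ S_{2n}} sgn(σ) ∏ᵢ x_{σ(2i-1),σ(2i)}` (§2.6, p0016:L14), and it is
characteristic-free ("the Pfaffian is well-defined even over fields of small characteristic").
This is the tree's `Literature.LinearAlgebra.Matrix.pfaffian` with the size argument explicit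
(`pfaffian_eq_matrixPfaffian`; erratum to the first version of this docstring, which overlooked it).
[cite: AndrewsForbes2022, §2.6] -/
def pfaffian : (k : ℕ) → Matrix (Fin k) (Fin k) R → R
  | 0, _ => 1
  | 1, _ => 0
  | k + 2, A => ∑ j : Fin (k + 1), (-1 : R) ^ (j : ℕ) * A 0 j.succ *
      pfaffian k (A.submatrix (fun i => (j.succAbove i).succ) (fun i => (j.succAbove i).succ))

/-- `Pf` of the empty matrix is `1`. [cite: AndrewsForbes2022, §2.6] -/
@[simp] theorem pfaffian_zero (A : Matrix (Fin 0) (Fin 0) R) : pfaffian 0 A = 1 := rfl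

/-- `Pf` of a `1 × 1` matrix is `0` ("if `X` is an `m × m` skew-symmetric matrix for odd `m`, then
`det(X) = 0`, so we restrict our attention to matrices of even order", p0016:L25). [cite: AndrewsForbes2022, §2.6] -/
@[simp] theorem pfaffian_one (A : Matrix (Fin 1) (Fin 1) R) : pfaffian 1 A = 0 := rfl

/-- `Pf ((a b),(c d)) = b`: for the skew-symmetric `((0 x),(-x 0))` this is `x`
("`[ij](X) = Pf ((0 x_{ij}),(-x_{ij} 0)) = x_{ij}`", p0016:L70). [cite: AndrewsForbes2022, §2.6 (Def. 2.29, remark)] -/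
@[simp] theorem pfaffian_two (A : Matrix (Fin 2) (Fin 2) R) : pfaffian 2 A = A 0 1 := by
  simp [pfaffian]

/-- **Bridge to the tree's Pfaffian**: `pfaffian k A` is `Literature.LinearAlgebra.Matrix.pfaffian A`
(same first-row expansion, Kustin–Ulrich (1.18); hence also the perfect-matching / printed form by
`Literature.Combinatorics.Enumerative.pfaffian_eq_matrixPfaffian`). [cite: AndrewsForbes2022, §2.6] -/
theorem pfaffian_eq_matrixPfaffian : ∀ (k : ℕ) (A : Matrix (Fin k) (Fin k) R),
    pfaffian k A = Literature.LinearAlgebra.Matrix.pfaffian A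
  | 0, _ => rfl
  | 1, _ => rfl
  | k + 2, A => by
    rw [pfaffian, Literature.LinearAlgebra.Matrix.pfaffian_fin_add_two]
    refine Finset.sum_congr rfl fun j _ => ?_
    rw [pfaffian_eq_matrixPfaffian k]
    rfl

/-- Index type of the variables `x_{i,j}`, `i < j`, of a generic skew-symmetric `k × k` matrix.
[cite: AndrewsForbes2022, §2.6] -/
abbrev SkewVarIdx (k : ℕ) : Type := {p : Fin k × Fin k // p.1 < p.2}

variable (R) in
/-- The **generic skew-symmetric `k × k` matrix** `X`: entries `x_{i,j}` above the diagonal,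
`-x_{j,i}` below ("the variables `x_{i,j}` and `x_{j,i}` satisfy the relation `x_{i,j} = -x_{j,i}`",
p0016:L11), `0` on the diagonal. [cite: AndrewsForbes2022, §2.6] -/
def skewX (k : ℕ) : Matrix (Fin k) (Fin k) (MvPolynomial (SkewVarIdx k) R) :=
  Matrix.of fun i j =>
    if h : i < j then X ⟨(i, j), h⟩ else if h' : j < i then -X ⟨(j, i), h'⟩ else 0

/-- `skewX` is skew-symmetric (`x_{i,j} = -x_{j,i}`, p0016:L11). [cite: AndrewsForbes2022, §2.6] -/
theorem skewX_transpose (k : ℕ) : (skewX R k)ᵀ = -skewX R k := by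
  ext i j
  simp only [skewX, transpose_apply, of_apply]
  by_cases h1 : i < j
  · have h2 : ¬ j < i := lt_asymm h1
    simp [h1, h2]
  · by_cases h2 : j < i
    · simp [h1, h2]
    · simp [h1, h2]

variable (R) in
/-- `Pf_s(X) := Pf(X_{[s],[s]})`, the Pfaffian of the leading principal `s × s` submatrix of the
generic skew-symmetric `k × k` matrix (Prop. 4.2, proof: "`Pf_k(D X Dᵀ) = Pf(D_{[k],[k]} X_{[k],[k]} Dᵀ_{[k],[k]})`",
p0026:L40); documented junk value `0` for `s > k` (never used: all parts occurring are `≤ k`).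
[cite: AndrewsForbes2022, §4.1 (proof of Prop. 4.2)] -/
def leadingPfaffian (k s : ℕ) : MvPolynomial (SkewVarIdx k) R :=
  if h : s ≤ k then pfaffian s ((skewX R k).submatrix (Fin.castLE h) (Fin.castLE h)) else 0

variable (R) in
/-- The standard monomial **`[K_σ](X) = ∏ᵢ Pf(X_{[σᵢ],[σᵢ]})`** (Def. 2.29 with `T = K_σ`, the
tableau whose `i`-th row is `(1, …, σᵢ)`, §3.1 p0019:L64 and §4.1 p0025:L9): the product of the
leading principal sub-Pfaffians of sizes the parts of `σ` (a multiset of parts; rows of Pfaffian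
tableaux have even length). [cite: AndrewsForbes2022, Def. 2.29 and §4.1] -/
def kPfaffMonomial (k : ℕ) (σ : Multiset ℕ) : MvPolynomial (SkewVarIdx k) R :=
  (σ.map (leadingPfaffian R k)).prod

/-- The empty shape gives `[K_∅] = 1`. [cite: AndrewsForbes2022, Def. 2.29] -/
@[simp] theorem kPfaffMonomial_zero (k : ℕ) : kPfaffMonomial R k 0 = 1 := by
  simp [kPfaffMonomial]

variable (R) in
/-- The ideal **`I^Pf_{2n,2r} ⊆ R[X]`** generated by the Pfaffians of the `2r × 2r` principal
submatrices `X_{S,S}` (`S ⊆ [2n]`, `|S| = 2r`, listed increasingly: an order embedding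
`Fin (2r) ↪o Fin (2n)`) of the generic skew-symmetric `2n × 2n` matrix (§2.6, p0016:L47;
§1.4.2). [cite: AndrewsForbes2022, §2.6] -/
def pfaffIdeal (n r : ℕ) : Ideal (MvPolynomial (SkewVarIdx (2 * n)) R) :=
  Ideal.span {p | ∃ ρ : Fin (2 * r) ↪o Fin (2 * n), p = pfaffian (2 * r) ((skewX R (2 * n)).submatrix ρ ρ)}

end Pfaffian

section HardnessPf

/-- The substitution `X ↦ P X Pᵀ` on the variables of the generic skew-symmetric matrix: the
variable `x_{i,j}` (`i < j`) goes to the `(i,j)` entry of `P X Pᵀ` (again skew-symmetric), for a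
`2n × 2n` matrix `P` of scalars of an `R`-algebra `S`. This is how "`f(ℓ_{1,1}(X,ε), …, ℓ_{2n,2n}(X,ε))`"
in Prop. 4.2 / Thm. 4.4 is to be read (the `ℓ_{i,j}` are the entries of `φ(MD) X φ(Dᵀ Mᵀ)`,
p0026:L75). [cite: AndrewsForbes2022, Prop. 4.2 (proof, last paragraph)] -/
def skewCongr {R : Type u} [CommRing R] {S : Type v} [CommRing S] [Algebra R S] {k : ℕ}
    (P : Matrix (Fin k) (Fin k) S) (f : MvPolynomial (SkewVarIdx k) R) : MvPolynomial (SkewVarIdx k) S :=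
  MvPolynomial.aeval
    (fun ij : SkewVarIdx k =>
      ((P.map (MvPolynomial.C : S →+* MvPolynomial (SkewVarIdx k) S) * skewX S k *
          (P.map (MvPolynomial.C : S →+* MvPolynomial (SkewVarIdx k) S))ᵀ :
        Matrix (Fin k) (Fin k) (MvPolynomial (SkewVarIdx k) S)) ij.1.1 ij.1.2)) f

/-- **Andrews–Forbes 2022, Proposition 4.2** (reduction of a nonzero `f ∈ I^Pf_{2n,2r}` to a single
standard monomial `[K_σ]` of width `≥ 2r`, p0026:L23): there are `4n²` linearly independent linear
functions `ℓ_{i,j}(X, ε) ∈ F(ε)[X]`, an integer `q`, a nonzero `α ∈ F` and a partition `σ` with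
`σ₁ ≥ 2r` such that `f(ℓ_{1,1}, …, ℓ_{2n,2n}) = ε^q α [K_σ](X) + O(ε^{q+1})`. Rendering (as the proof
constructs them, p0026:L75): the `ℓ_{i,j}` are the entries of `P X Pᵀ` for an invertible
`P ∈ F(ε)^{2n × 2n}` (`skewCongr`); `O(ε^{q+1})` is the tree's `IsBigOEps` coefficientwise, as in the
tree's Prop. 3.5; the parts of `σ` are even, positive and `≤ 2n` (rows of Pfaffian standard
tableaux, Def. 2.29), `σ₁ ≥ 2r` is `2r ≤ σ.sup`. Characteristic zero, as the tree vendors Prop. 3.5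
(the paper states its results over characteristic zero "for simplicity", §1.4 p0007:L3).
[cite: AndrewsForbes2022, Prop. 4.2] -/
def AndrewsForbes2022_prop_4_2 : Prop :=
  ∀ (F : Type) [Field F] [CharZero F] (n r : ℕ), 0 < r → r ≤ n →
  ∀ f : MvPolynomial (SkewVarIdx (2 * n)) F, f ∈ pfaffIdeal F n r → f ≠ 0 →
    ∃ (P : Matrix (Fin (2 * n)) (Fin (2 * n)) (RatFunc F)) (q : ℤ) (α : F) (σ : Multiset ℕ),
      IsUnit P ∧ α ≠ 0 ∧ 2 * r ≤ σ.sup ∧ (∀ s ∈ σ, Even s ∧ 0 < s ∧ s ≤ 2 * n) ∧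
      ∀ e : SkewVarIdx (2 * n) →₀ ℕ,
        IsBigOEps F (q + 1) (MvPolynomial.coeff e
          (skewCongr P f -
            MvPolynomial.C (RatFunc.X ^ q * algebraMap F (RatFunc F) α) *
              MvPolynomial.map (algebraMap F (RatFunc F)) (kPfaffMonomial F (2 * n) σ)))

/-- **Andrews–Forbes 2022, Lemma 4.3** (p0027:L15): for every `n × n` matrix `A` there is a
`2n × 2n` skew-symmetric matrix `M` with `Pf(M_{[2k],[2k]}) = ± det(A_{[k],[k]})` for every
`k ∈ [n]` (here all `k ≤ n`; `k = 0` reads `1 = 1`). Over any commutative ring: the paper states it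
for "an `n × n` matrix" and applies it to `A(y, z) ∈ F[ε][y, z]^{n × n}` (p0027:L115); the proof (a
permutation conjugate of `((0 A),(-Aᵀ 0))`, Lemmas 2.27–2.28) is ring-agnostic.
[cite: AndrewsForbes2022, Lemma 4.3] -/
def AndrewsForbes2022_lemma_4_3 : Prop :=
  ∀ (R : Type) [CommRing R] (n : ℕ) (A : Matrix (Fin n) (Fin n) R),
    ∃ M : Matrix (Fin (2 * n)) (Fin (2 * n)) R, Mᵀ = -M ∧ (∀ i, M i i = 0) ∧
      ∀ (k : ℕ) (hk : k ≤ n), ∃ e : ℕ,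
        pfaffian (2 * k) (M.submatrix (Fin.castLE (Nat.mul_le_mul_left 2 hk))
            (Fin.castLE (Nat.mul_le_mul_left 2 hk))) =
          (-1) ^ e * (A.submatrix (Fin.castLE hk) (Fin.castLE hk)).det

/-- **Andrews–Forbes 2022, Theorem 4.4** (Pfaffian analogue of Thm. 3.8, char `0` bullet,
p0027:L85): `X` a generic skew-symmetric `2n × 2n` matrix, `f` a nonzero polynomial in the ideal
generated by the Pfaffians of the principal `2r × 2r` submatrices, `h(X, ε) ∈ F⟦ε⟧[X]` with
`h = f + O(ε)`, `g(y)` in the border of layered ABPs with at most `r` vertices: there is a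
depth-three `h`-oracle circuit over `F(ε)` (one bottom addition gate per variable of `X` — printed
"`nm`", erratum, cf. Cor. 4.5's `4n²` — one oracle gate, one top addition gate) computing
`g(y) + O(ε)`. [cite: AndrewsForbes2022, Thm. 4.4] -/
def AndrewsForbes2022_thm_4_4 : Prop :=
  ∀ (F : Type) [Field F] [CharZero F] (n r : ℕ) (f : MvPolynomial (SkewVarIdx (2 * n)) F),
    f ∈ pfaffIdeal F n r → f ≠ 0 →
  ∀ h : MvPolynomial (SkewVarIdx (2 * n)) (LaurentSeries F),
    PolyOrdGE 1 (h - MvPolynomial.map (algebraMap F (LaurentSeries F)) f) →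
  ∀ (ι : Type) (g : MvPolynomial ι F), InLayeredABPBorder r g →
    DepthThreeOracleComputes h (MvPolynomial.map (algebraMap F (LaurentSeries F)) g)

/-- **Andrews–Forbes 2022, Theorem 4.4, positive-characteristic bullet**: with `char F = p > 0` the
circuit computes `g(y)^{p^k} + O(ε)` for some `k` (p0027:L97). [cite: AndrewsForbes2022, Thm. 4.4 (third bullet)] -/
def AndrewsForbes2022_thm_4_4_posChar : Prop :=
  ∀ (p : ℕ) [Fact p.Prime] (F : Type) [Field F] [CharP F p] (n r : ℕ)
    (f : MvPolynomial (SkewVarIdx (2 * n)) F), f ∈ pfaffIdeal F n r → f ≠ 0 →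
  ∀ h : MvPolynomial (SkewVarIdx (2 * n)) (LaurentSeries F),
    PolyOrdGE 1 (h - MvPolynomial.map (algebraMap F (LaurentSeries F)) f) →
  ∀ (ι : Type) (g : MvPolynomial ι F), InLayeredABPBorder r g →
    ∃ e : ℕ, DepthThreeOracleComputes h (MvPolynomial.map (algebraMap F (LaurentSeries F)) (g ^ p ^ e))

/-- **Andrews–Forbes 2022, Corollary 4.5** (char `0` bullet, p0028:L63): for nonzero
`f ∈ I^Pf_{2n,2r}`, `h = f + O(ε)` and `t ≤ O(r^{1/3})`, a depth-three `h`-oracle circuit (`4n²`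
bottom addition gates, one oracle gate, one top addition gate) computes the Pfaffian `+ O(ε)`
(proof: the [MSV04, Thm. 12] layered ABP of size `O(t³)` for the `2t × 2t` Pfaffian, then
Thm. 4.4). The printed "`Pf_t(X)`", `t ≤ O(r^{1/3})`, is rendered as the Pfaffian of the generic
skew-symmetric `2t × 2t` matrix with `c t³ ≤ r` for an unnamed absolute constant `c`.
[cite: AndrewsForbes2022, Cor. 4.5] -/
def AndrewsForbes2022_cor_4_5 : Prop :=
  ∃ c : ℕ, ∀ (F : Type) [Field F] [CharZero F] (n r : ℕ) (f : MvPolynomial (SkewVarIdx (2 * n)) F),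
    f ∈ pfaffIdeal F n r → f ≠ 0 →
  ∀ h : MvPolynomial (SkewVarIdx (2 * n)) (LaurentSeries F),
    PolyOrdGE 1 (h - MvPolynomial.map (algebraMap F (LaurentSeries F)) f) →
  ∀ t : ℕ, c * t ^ 3 ≤ r →
    DepthThreeOracleComputes h
      (MvPolynomial.map (algebraMap F (LaurentSeries F)) (pfaffian (2 * t) (skewX F (2 * t))))

/-- The proof of Cor. 4.5 as printed, from Thm. 4.4 and a layered ABP with `c t³` vertices for the
`2t × 2t` Pfaffian (the role of [MSV04, Thm. 12], p0028:L74) taken as hypotheses.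
[cite: AndrewsForbes2022, Cor. 4.5 (proof)] -/
theorem AndrewsForbes2022_cor_4_5_of (h44 : AndrewsForbes2022_thm_4_4) {c : ℕ}
    (hpf : ∀ (F : Type) [Field F] (t : ℕ),
      LayeredABPComputes (c * t ^ 3) (pfaffian (2 * t) (skewX F (2 * t))))
    (F : Type) [Field F] [CharZero F] (n r : ℕ) (f : MvPolynomial (SkewVarIdx (2 * n)) F)
    (hf : f ∈ pfaffIdeal F n r) (hf0 : f ≠ 0) (h : MvPolynomial (SkewVarIdx (2 * n)) (LaurentSeries F))
    (hh : PolyOrdGE 1 (h - MvPolynomial.map (algebraMap F (LaurentSeries F)) f))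
    (t : ℕ) (ht : c * t ^ 3 ≤ r) :
    DepthThreeOracleComputes h
      (MvPolynomial.map (algebraMap F (LaurentSeries F)) (pfaffian (2 * t) (skewX F (2 * t)))) :=
  h44 F n r f hf hf0 h hh _ _ (InLayeredABPBorder.of_computes ((hpf F t).mono ht))

end HardnessPf

/-! ### §2.4 (Def. 2.13, Lemma 2.14, Def. 2.19): Hasse derivatives and the spaces `∂_{<∞}`, `∂_{≤d}` -/

section Hasse

variable {R : Type u} [CommSemiring R] {σ : Type v}

/-- The **`a`-th Hasse derivative** `∂/∂x^a (f) = Coeff_{y^a} f(x + y)` (Def. 2.13, p0014:L25),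
defined through its action on monomials (Lemma 2.14, p0014:L37):
`∂/∂x^a (x^b) = ∏ᵢ binom(bᵢ, aᵢ) x^{b - a}` (`binom(b, a) = 0` if `b < a`; then also `b - a` is
truncated, harmlessly). "Originally defined by Hasse … more well-behaved over fields of small
positive characteristic"; Mathlib has only the one-variable `Polynomial.hasseDeriv`.
[cite: AndrewsForbes2022, Def. 2.13 and Lemma 2.14] -/
def mvHasseDeriv (a : σ →₀ ℕ) (f : MvPolynomial σ R) : MvPolynomial σ R :=
  ∑ b ∈ f.support, monomial (b - a) ((a.prod fun i k => ((b i).choose k : R)) * coeff b f)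

/-- **Lemma 2.14** on monomials (with a coefficient): `∂/∂x^a (c x^b) = (∏ᵢ binom(bᵢ,aᵢ)) c x^{b-a}`.
[cite: AndrewsForbes2022, Lemma 2.14] -/
theorem mvHasseDeriv_monomial (a b : σ →₀ ℕ) (c : R) :
    mvHasseDeriv a (monomial b c) = monomial (b - a) ((a.prod fun i k => ((b i).choose k : R)) * c) := by
  classical
  by_cases hc : c = 0
  · simp [mvHasseDeriv, hc]
  · simp [mvHasseDeriv, support_monomial, hc]

/-- The zeroth Hasse derivative is the identity (Lemma 2.14 with `a = 0`). [cite: AndrewsForbes2022, Lemma 2.14] -/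
@[simp] theorem mvHasseDeriv_zero_left (f : MvPolynomial σ R) : mvHasseDeriv 0 f = f := by
  simp only [mvHasseDeriv, tsub_zero, Finsupp.prod_zero_index, one_mul]
  exact support_sum_monomial_coeff f

variable {F : Type u} [Field F]

/-- **`∂_{<∞}(f)`**, the space of (Hasse) partial derivatives of all orders of `f` (Def. 2.19,
p0014:L93): the `F`-span of `{∂f/∂x^a : a ∈ ℕ^σ}`. [cite: AndrewsForbes2022, Def. 2.19] -/
def partialSpace (f : MvPolynomial σ F) : Submodule F (MvPolynomial σ F) :=
  Submodule.span F (Set.range fun a : σ →₀ ℕ => mvHasseDeriv a f)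

/-- **`∂_{≤d}(f)`**, the space of (Hasse) partial derivatives of order at most `d` of `f`
(Def. 2.19): the `F`-span of `{∂f/∂x^a : |a|₁ ≤ d}`. [cite: AndrewsForbes2022, Def. 2.19] -/
def partialSpaceLE (d : ℕ) (f : MvPolynomial σ F) : Submodule F (MvPolynomial σ F) :=
  Submodule.span F ((fun a : σ →₀ ℕ => mvHasseDeriv a f) '' {a : σ →₀ ℕ | Finsupp.degree a ≤ d})

/-- `∂_{≤d}(f) ⊆ ∂_{<∞}(f)` (Def. 2.19: `∂_{≤d}` is spanned by a subset of the generators of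
`∂_{<∞}`). [cite: AndrewsForbes2022, Def. 2.19] -/
theorem partialSpaceLE_le (d : ℕ) (f : MvPolynomial σ F) : partialSpaceLE d f ≤ partialSpace f :=
  Submodule.span_mono (by rintro _ ⟨a, -, rfl⟩; exact ⟨a, rfl⟩)

/-- `f ∈ ∂_{≤d}(f)` (order `0`, Def. 2.19 with `∂_0(f) = span{f}`). [cite: AndrewsForbes2022, Def. 2.19] -/
theorem self_mem_partialSpaceLE (d : ℕ) (f : MvPolynomial σ F) : f ∈ partialSpaceLE d f :=
  Submodule.subset_span ⟨0, by simp, by simp⟩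

/-- **Lemma 2.20** (p0014:L117): for `A ∈ F^{n × n}`, `dim ∂_{≤d}(f(A x)) ≤ dim ∂_{≤d}(f(x))`, with
equality if `A` is invertible ("by taking `d ≥ deg f` one can replace `∂_{≤d}` with `∂_{<∞}`",
p0015:L9). `f(A x)` is `aeval (fun i => Σ_j A i j • X j) f`. [cite: AndrewsForbes2022, Lemma 2.20] -/
def AndrewsForbes2022_lemma_2_20 : Prop :=
  ∀ (F : Type) [Field F] (n : ℕ) (f : MvPolynomial (Fin n) F) (A : Matrix (Fin n) (Fin n) F) (d : ℕ),
    Module.finrank F (partialSpaceLE d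
        (MvPolynomial.aeval (fun i => ∑ j, A i j • (X j : MvPolynomial (Fin n) F)) f)) ≤
        Module.finrank F (partialSpaceLE d f) ∧
      (IsUnit A →
        Module.finrank F (partialSpaceLE d
          (MvPolynomial.aeval (fun i => ∑ j, A i j • (X j : MvPolynomial (Fin n) F)) f)) =
          Module.finrank F (partialSpaceLE d f))

end Hasse

/-! ### §2.5 (Def. 2.23): general bideterminants `(S | T)(X)` and their width -/

section Bideterminant

variable (F : Type u) [Field F] {n m : ℕ}

/-- A row of a bitableau `(S, T)` on an `n × m` matrix: its length `k` and the row indices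
`S(i, ·) : Fin k → Fin n`, column indices `T(i, ·) : Fin k → Fin m` (Def. 2.23, p0015:L60; as in
Lemma 5.1 "we abuse notation and allow a bitableau to have rows whose lengths are not necessarily
nonincreasing", p0029:L37 — shape conditions are predicates, not part of the data).
[cite: AndrewsForbes2022, Def. 2.23] -/
abbrev BitableauRow (n m : ℕ) : Type := Σ k : ℕ, (Fin k → Fin n) × (Fin k → Fin m)

/-- A bitableau: a list of rows. [cite: AndrewsForbes2022, Def. 2.23] -/
abbrev Bitableau (n m : ℕ) : Type := List (BitableauRow n m)

/-- The minor `det X_{S(i,·),T(i,·)}` attached to one row of a bitableau (the `i`-th factor in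
Def. 2.23). [cite: AndrewsForbes2022, Def. 2.23] -/
def rowMinor (ρ : BitableauRow n m) : MvPolynomial (Fin n × Fin m) F :=
  ((mvPolynomialX (Fin n) (Fin m) F).submatrix ρ.2.1 ρ.2.2).det

/-- The **bideterminant** `(S | T)(X) = ∏ᵢ det X_{S(i,·),T(i,·)}` of a bitableau (Def. 2.23,
p0015:L60). The tree's `kBideterminant F n m σ` is the case `S = T = K_σ`. [cite: AndrewsForbes2022, Def. 2.23] -/
def bideterminant (B : Bitableau n m) : MvPolynomial (Fin n × Fin m) F :=
  (B.map (rowMinor F)).prod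

/-- The **width** of a bitableau/bideterminant: the length of its longest row (`= σ₁` for a shape
`σ` that is a partition, Def. 2.23 "The width of the bideterminant `(S|T)` is given by `σ₁`").
[cite: AndrewsForbes2022, Def. 2.23] -/
def Bitableau.width (B : Bitableau n m) : ℕ :=
  (B.map Sigma.fst).foldr max 0

/-- The empty bitableau has bideterminant `1`. [cite: AndrewsForbes2022, Def. 2.23] -/
@[simp] theorem bideterminant_nil : bideterminant F ([] : Bitableau n m) = 1 := by
  simp [bideterminant]

/-- Adding a row multiplies by its minor (Def. 2.23 is this product). [cite: AndrewsForbes2022, Def. 2.23] -/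
theorem bideterminant_cons (ρ : BitableauRow n m) (B : Bitableau n m) :
    bideterminant F (ρ :: B) = rowMinor F ρ * bideterminant F B := by
  simp [bideterminant]

/-- A one-row bitableau of length `1` is the variable `x_{i,j}` (the monomial basis inside the
bideterminants, p0015:L100). [cite: AndrewsForbes2022, §2.5 (remark after Def. 2.23)] -/
theorem bideterminant_singleton_one (i : Fin n) (j : Fin m) :
    bideterminant F [⟨1, fun _ => i, fun _ => j⟩] = X (i, j) := by
  simp [bideterminant, rowMinor, Matrix.det_unique, mvPolynomialX]

end Bideterminant

/-! ### §5: Proposition 5.3 and Theorem 5.4 -/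

section Partials

/-- **Andrews–Forbes 2022, Proposition 5.3** (first part, any characteristic; p0030:L45): a nonzero
bideterminant `(S | T)` of width `r` has `dim ∂_{<∞}((S | T)) ≥ binom(2r, r)`.
[cite: AndrewsForbes2022, Prop. 5.3] -/
def AndrewsForbes2022_prop_5_3 : Prop :=
  ∀ (F : Type) [Field F] (n m : ℕ) (B : Bitableau n m), bideterminant F B ≠ 0 →
    (2 * B.width).choose B.width ≤ Module.finrank F (partialSpace (bideterminant F B))

/-- **Andrews–Forbes 2022, Proposition 5.3** (second part, `char F = 0`): moreover
`dim ∂_{≤d}((S | T)) ≥ Σ_{i=0}^{d} binom(r, i)²`. [cite: AndrewsForbes2022, Prop. 5.3 (char 0 clause)] -/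
def AndrewsForbes2022_prop_5_3_charZero : Prop :=
  ∀ (F : Type) [Field F] [CharZero F] (n m : ℕ) (B : Bitableau n m), bideterminant F B ≠ 0 →
    ∀ d : ℕ, ∑ i ∈ Finset.range (d + 1), (B.width.choose i) ^ 2 ≤
      Module.finrank F (partialSpaceLE d (bideterminant F B))

/-- **Andrews–Forbes 2022, Theorem 5.4** (first part, any characteristic; p0030:L108): for every
nonzero `f ∈ I^det_{n,m,r}`, `dim ∂_{<∞}(f) ≥ binom(2r, r)` (`= dim ∂_{<∞}(det_r)`, see
`AndrewsForbes2022_dim_partialSpace_det`): "the `r × r` determinant is of minimal complexity in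
`I^det_{n,m,r}`" for this measure. [cite: AndrewsForbes2022, Thm. 5.4] -/
def AndrewsForbes2022_thm_5_4 : Prop :=
  ∀ (F : Type) [Field F] (n m r : ℕ) (f : MvPolynomial (Fin n × Fin m) F),
    f ∈ detIdeal F n m r → f ≠ 0 → (2 * r).choose r ≤ Module.finrank F (partialSpace f)

/-- **Andrews–Forbes 2022, Theorem 5.4** (second part, `char F = 0`): for every nonzero
`f ∈ I^det_{n,m,r}` and every `d`, `dim ∂_{≤d}(f) ≥ Σ_{i=0}^{d} binom(r, i)²` (Remark 5.5, p0031:L1: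
the hypothesis `char F = 0` cannot be dropped — `∂(f^p)/∂xᵢ = 0`).
[cite: AndrewsForbes2022, Thm. 5.4 (char 0 clause)] -/
def AndrewsForbes2022_thm_5_4_charZero : Prop :=
  ∀ (F : Type) [Field F] [CharZero F] (n m r : ℕ) (f : MvPolynomial (Fin n × Fin m) F),
    f ∈ detIdeal F n m r → f ≠ 0 →
    ∀ d : ℕ, ∑ i ∈ Finset.range (d + 1), (r.choose i) ^ 2 ≤ Module.finrank F (partialSpaceLE d f)

/-- The value **`dim ∂_{<∞}(det_r) = binom(2r, r)`** printed in Thm. 5.4 / §1.4.3 Thm. 1.3 / §5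
("Since `det_r(X) ∈ I^det_{n,m,r}` and `dim(∂_{<∞}(det_r)) = binom(2r, r)`", p0029:L17; the
order-`k` partials of `det_r` span the `(r-k) × (r-k)` minors, `Σ_k binom(r,k)² = binom(2r,r)` —
cf. the tree's `flatteningRank_detPoly` for the graded pieces with ordinary derivatives).
[cite: AndrewsForbes2022, Thm. 5.4 (the equality) and §5 (p. 29)] -/
def AndrewsForbes2022_dim_partialSpace_det : Prop :=
  ∀ (F : Type) [Field F] (r : ℕ),
    Module.finrank F (partialSpace (detPoly (Fin r) F)) = (2 * r).choose r

/-- Thm. 5.4 for the generators: every `r × r` minor of `X` (`r ≤ min(n,m)`, row/column selections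
injective so that the minor is a nonzero bideterminant of width `r`) has
`dim ∂_{<∞} ≥ binom(2r, r)` — the one-row case of Prop. 5.3, recorded as the instance the theorem
generalises ("we clearly have `dim ∂_{<∞}(I^det_{n,m,r}) ≤ binom(2r,r)`", p0029:L17).
[cite: AndrewsForbes2022, §5 (p. 29) with Prop. 5.3] -/
theorem choose_le_finrank_partialSpace_minor (h53 : AndrewsForbes2022_prop_5_3) (F : Type) [Field F]
    {n m r : ℕ} (ρ : Fin r → Fin n) (γ : Fin r → Fin m)
    (h0 : ((mvPolynomialX (Fin n) (Fin m) F).submatrix ρ γ).det ≠ 0) :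
    (2 * r).choose r ≤
      Module.finrank F (partialSpace ((mvPolynomialX (Fin n) (Fin m) F).submatrix ρ γ).det) := by
  have hB : bideterminant F [⟨r, ρ, γ⟩] = ((mvPolynomialX (Fin n) (Fin m) F).submatrix ρ γ).det := by
    simp [bideterminant, rowMinor]
  have hw : Bitableau.width ([⟨r, ρ, γ⟩] : Bitableau n m) = r := by
    simp [Bitableau.width]
  have := h53 F n m [⟨r, ρ, γ⟩] (hB ▸ h0)
  rwa [hw, hB] at this

end Partials

/-! ### Proof of Lemma 3.7 (homogenisation of a layered ABP): `AndrewsForbes2022_lemma_3_7_holds` -/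

section Lemma37Proof

variable {R : Type u} [CommRing R] {ι : Type v}

/-! The printed proof (p0023:L11–L27) relabels every edge `ℓ_e(y) = α₀ + Σᵢ αᵢ yᵢ` by its
homogenisation `ℓ̂_e(y, z) = α₀ z + Σᵢ αᵢ yᵢ`; with `z = X none` this is
`rename some ℓ + C α₀ * (X none - 1)`, written out inline below (no new definition). -/

/-- Setting `z ↦ 1` recovers the label: `ℓ̂_e(y, 1) = ℓ_e(y)` (p0023:L24).
[cite: AndrewsForbes2022, Lemma 3.7 (proof)] -/
private theorem aeval_homog (p : MvPolynomial ι R) :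
    MvPolynomial.aeval (fun o : Option ι => o.elim (1 : MvPolynomial ι R) X)
      (rename some p + C (coeff 0 p) * (X none - 1)) = p := by
  have hcomp : (fun o : Option ι => o.elim (1 : MvPolynomial ι R) X) ∘ some = X :=
    funext fun _ => rfl
  rw [map_add, map_mul, map_sub, map_one, aeval_C, aeval_X, aeval_rename, hcomp,
    aeval_X_left_apply]
  have h1 : (none : Option ι).elim (1 : MvPolynomial ι R) X = 1 := rfl
  rw [h1, sub_self, mul_zero, add_zero]

/-- A variable has total degree `≤ 1` (also over the trivial ring). [folklore] -/
private theorem totalDegree_X_le_one_AF {τ : Type w} (i : τ) :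
    (X i : MvPolynomial τ R).totalDegree ≤ 1 := by
  rcases subsingleton_or_nontrivial R with hR | hR
  · rw [Subsingleton.elim (X i : MvPolynomial τ R) 0, totalDegree_zero]; exact zero_le_one
  · rw [totalDegree_X]

/-- The homogenised label is still affine-linear (p0023:L22). [cite: AndrewsForbes2022, Lemma 3.7 (proof)] -/
private theorem totalDegree_homog_le {p : MvPolynomial ι R} (hp : p.totalDegree ≤ 1) :
    (rename some p + C (coeff 0 p) * (X none - 1)).totalDegree ≤ 1 := by
  refine (totalDegree_add _ _).trans (max_le ?_ ?_)
  · exact (totalDegree_rename_le _ _).trans hp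
  · refine (totalDegree_mul _ _).trans ?_
    rw [totalDegree_C, zero_add]
    refine (totalDegree_sub _ _).trans (max_le (totalDegree_X_le_one_AF _) ?_)
    rw [totalDegree_one]; exact zero_le_one

/-- An affine-linear polynomial without constant term is homogeneous of degree `1`. [folklore] -/
private theorem isHomogeneous_one_of_totalDegree_le {τ : Type w} {q : MvPolynomial τ R}
    (hq : q.totalDegree ≤ 1) (h0 : coeff 0 q = 0) : q.IsHomogeneous 1 := by
  intro d hd
  have hmem : d ∈ q.support := by simpa [mem_support_iff] using hd
  have hle : Finsupp.degree d ≤ 1 := (le_totalDegree hmem).trans hq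
  have hne : d ≠ 0 := by rintro rfl; exact hd h0
  have hge : Finsupp.degree d ≠ 0 := fun h => hne ((Finsupp.degree_eq_zero_iff d).mp h)
  have key : Finsupp.weight (1 : τ → ℕ) d = Finsupp.degree d := by
    rw [Finsupp.degree_eq_weight_one]; rfl
  show Finsupp.weight (1 : τ → ℕ) d = 1
  rw [key]
  omega

/-- "Each nonzero `ℓ̂_{u→v}(y, z)` is a homogeneous degree-1 polynomial" (p0023:L22).
[cite: AndrewsForbes2022, Lemma 3.7 (proof)] -/
private theorem isHomogeneous_homog {p : MvPolynomial ι R} (hp : p.totalDegree ≤ 1) :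
    (rename some p + C (coeff 0 p) * (X none - 1)).IsHomogeneous 1 := by
  have hsplit : rename some p + C (coeff 0 p) * (X none - 1) =
      rename some (p - C (coeff 0 p)) + C (coeff 0 p) * X none := by
    simp only [map_sub, rename_C]; ring
  rw [hsplit]
  refine IsHomogeneous.add ?_ ((isHomogeneous_X (R := R) none).C_mul _)
  refine (isHomogeneous_one_of_totalDegree_le ?_ ?_).rename_isHomogeneous
  · exact (totalDegree_sub_C_le _ _).trans hp
  · simp

/-- Entries of powers of a matrix of degree-`1` homogeneous polynomials: "the polynomial
`ĝ_v(y, z)` is homogeneous of degree `i`" for `v` in layer `i` (p0023:L19), here as the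
`L`-th matrix power. [cite: AndrewsForbes2022, Lemma 3.7 (proof)] -/
theorem isHomogeneous_pow_apply {k : ℕ} {τ : Type w} (N : Matrix (Fin k) (Fin k) (MvPolynomial τ R))
    (hN : ∀ u v, (N u v).IsHomogeneous 1) (L : ℕ) (u v : Fin k) : ((N ^ L) u v).IsHomogeneous L := by
  induction L generalizing v with
  | zero =>
    rw [pow_zero, Matrix.one_apply]
    split_ifs
    · exact isHomogeneous_one _ _
    · exact isHomogeneous_zero _ _ _
  | succ L ih =>
    rw [pow_succ, Matrix.mul_apply]
    exact IsHomogeneous.sum _ _ _ fun w _ => (ih w).mul (hN w v)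

/-- **Discharge of `AndrewsForbes2022_lemma_3_7`**, following the printed proof: relabel every
edge by its homogenisation `α₀ z + Σ αᵢ yᵢ`; the layer-`i` vertices then compute homogeneous
degree-`i` polynomials which specialise to the original ones at `z = 1` (p0023:L11–L27).
[cite: AndrewsForbes2022, Lemma 3.7] -/
theorem AndrewsForbes2022_lemma_3_7_holds : AndrewsForbes2022_lemma_3_7 := by
  intro R _ ι m g hg
  obtain ⟨k, hk, layer, s, t, N, h1, h2, h3⟩ := hg
  set N' : Matrix (Fin k) (Fin k) (MvPolynomial (Option ι) R) :=
    N.map fun p => rename some p + C (coeff 0 p) * (X none - 1) with hN'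
  refine ⟨(N' ^ (layer t - layer s)) s t, layer t - layer s, ?_, ?_, ?_⟩
  · exact isHomogeneous_pow_apply _ (fun u v => isHomogeneous_homog (h2 u v)) _ s t
  · refine ⟨k, hk, layer, s, t, N', ?_, ?_, rfl⟩
    · intro u v huv
      refine h1 u v fun h0 => huv ?_
      simp [hN', h0]
    · intro u v
      exact totalDegree_homog_le (h2 u v)
  · rw [← h3]
    set φ : Option ι → MvPolynomial ι R := fun o => o.elim (1 : MvPolynomial ι R) X with hφ
    have hmat : (MvPolynomial.aeval φ).mapMatrix N' = N := by
      refine Matrix.ext fun u v => ?_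
      simp only [AlgHom.mapMatrix_apply, Matrix.map_apply, hφ, hN']
      exact aeval_homog (N u v)
    have := congrArg (fun M => M s t) (map_pow (MvPolynomial.aeval φ).mapMatrix N'
      (layer t - layer s))
    simp only [hmat, AlgHom.mapMatrix_apply, Matrix.map_apply] at this
    exact this

end Lemma37Proof

/-! ### Corollary 3.10 from Theorem 3.8: the layered ABP for `IMM_{w,d}` on `w(d-1)+2` vertices -/

section Transport

variable {R : Type u} [CommSemiring R] {ι : Type v}

/-- A layered ABP on an arbitrary finite vertex type with at most `m` vertices gives
`LayeredABPComputes m` (transport along `Fintype.equivFin`). [cite: AndrewsForbes2022, §3.2 (Lemma 3.6, Thm. 3.8)] -/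
theorem layeredABPComputes_of_fintype {V : Type} [Fintype V] [DecidableEq V] {m : ℕ}
    (hV : Fintype.card V ≤ m) (layer : V → ℕ) (s t : V) (N : Matrix V V (MvPolynomial ι R))
    (h1 : ∀ u v, N u v ≠ 0 → layer v = layer u + 1) (h2 : ∀ u v, (N u v).totalDegree ≤ 1) :
    LayeredABPComputes m ((N ^ (layer t - layer s)) s t) := by
  classical
  set e := Fintype.equivFin V with he
  refine ⟨Fintype.card V, hV, layer ∘ e.symm, e s, e t, Matrix.reindex e e N, ?_, ?_, ?_⟩
  · intro u v huv
    have := h1 (e.symm u) (e.symm v) (by simpa [Matrix.reindex_apply] using huv)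
    simpa using this
  · intro u v
    simpa [Matrix.reindex_apply] using h2 (e.symm u) (e.symm v)
  · have hpow : (Matrix.reindex e e N) ^ (layer t - layer s) =
        Matrix.reindex e e (N ^ (layer t - layer s)) := by
      have := map_pow (Matrix.reindexAlgEquiv R (MvPolynomial ι R) e) N (layer t - layer s)
      simpa [Matrix.coe_reindexAlgEquiv] using this.symm
    simp only [Function.comp_apply, Equiv.symm_apply_apply]
    rw [hpow, Matrix.reindex_apply, Matrix.submatrix_apply, Equiv.symm_apply_apply,
      Equiv.symm_apply_apply]

end Transport

section IMMABP

variable (F : Type u) [Field F]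

/-- Vertices of the layered ABP for `IMM_{w,e+1}`: source, `e` middle layers of width `w`, sink
(`w e + 2 = w (d-1) + 2` vertices, `d = e + 1`). [cite: AndrewsForbes2022, Cor. 3.10 (proof)] -/
abbrev IMMVtx (w e : ℕ) : Type := Unit ⊕ ((Fin e × Fin w) ⊕ Unit)

/-- Layers: source `0`, middle layer `i ↦ i + 1`, sink `e + 1`. [cite: AndrewsForbes2022, Cor. 3.10 (proof)] -/
def immLayer (w e : ℕ) : IMMVtx w e → ℕ
  | Sum.inl _ => 0
  | Sum.inr (Sum.inl p) => (p.1 : ℕ) + 1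
  | Sum.inr (Sum.inr _) => e + 1

/-- Edge labels: source → layer 1 by row `0` of `X^{(0)}`, layer `i` → layer `i+1` by `X^{(i)}`,
last middle layer → sink by column `0` of `X^{(e)}`; for `e = 0` the single edge source → sink
labelled `X^{(0)}_{0,0}`. [cite: AndrewsForbes2022, Cor. 3.10 (proof)] -/
def immLabel (w e : ℕ) [NeZero w] :
    IMMVtx w e → IMMVtx w e → MvPolynomial (Fin (e + 1) × Fin w × Fin w) F
  | Sum.inl _, Sum.inr (Sum.inl p) => if (p.1 : ℕ) = 0 then X (0, 0, p.2) else 0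
  | Sum.inl _, Sum.inr (Sum.inr _) => if e = 0 then X (0, 0, 0) else 0
  | Sum.inr (Sum.inl p), Sum.inr (Sum.inl q) =>
      if (q.1 : ℕ) = p.1 + 1 then X (p.1.succ, p.2, q.2) else 0
  | Sum.inr (Sum.inl p), Sum.inr (Sum.inr _) =>
      if (p.1 : ℕ) + 1 = e then X (Fin.last e, p.2, 0) else 0
  | _, _ => 0

/-- The `t`-th generic factor `X^{(t)}` of `immMatrix`. [cite: AndrewsForbes2022, Cor. 3.10 (proof)] -/
def immFactor (w e : ℕ) (t : Fin (e + 1)) : Matrix (Fin w) (Fin w) (MvPolynomial (Fin (e + 1) × Fin w × Fin w) F) :=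
  (mvPolynomialX (Fin w) (Fin w) F).map (rename fun ij : Fin w × Fin w => (t, ij))

variable {F}

/-- Entries of the generic factor: `X^{(t)}_{a,b}`. [cite: AndrewsForbes2022, Cor. 3.10 (proof)] -/
@[simp] theorem immFactor_apply (w e : ℕ) (t : Fin (e + 1)) (a b : Fin w) :
    immFactor F w e t a b = X (t, a, b) := by
  simp [immFactor, mvPolynomialX, rename_X]

/-- `immMatrix` is the list product of the generic factors. [cite: AndrewsForbes2022, Cor. 3.10 (proof)] -/
theorem immMatrix_eq_prod (w e : ℕ) :
    immMatrix (Fin w) (e + 1) F = ((List.finRange (e + 1)).map (immFactor F w e)).prod := rfl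

variable (F) in
/-- Prefix products `X^{(0)} ⋯ X^{(i)}` (the polynomials at layer `i+1`). [cite: AndrewsForbes2022, Cor. 3.10 (proof)] -/
def immPrefix (w e i : ℕ) : Matrix (Fin w) (Fin w) (MvPolynomial (Fin (e + 1) × Fin w × Fin w) F) :=
  (((List.finRange (e + 1)).map (immFactor F w e)).take (i + 1)).prod

/-- The first prefix product is `X^{(0)}`. [cite: AndrewsForbes2022, Cor. 3.10 (proof)] -/
theorem immPrefix_zero (w e : ℕ) : immPrefix F w e 0 = immFactor F w e 0 := by
  rw [immPrefix, ← List.map_take, List.finRange_succ]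
  simp

/-- Prefix products grow by one factor. [cite: AndrewsForbes2022, Cor. 3.10 (proof)] -/
theorem immPrefix_succ (w e i : ℕ) (h : i + 1 < e + 1) :
    immPrefix F w e (i + 1) = immPrefix F w e i * immFactor F w e ⟨i + 1, h⟩ := by
  unfold immPrefix
  rw [List.take_add_one, List.prod_append]
  congr 1
  have hlen : i + 1 < ((List.finRange (e + 1)).map (immFactor F w e)).length := by
    simpa using h
  rw [List.getElem?_eq_getElem hlen]
  simp [List.getElem_finRange]

/-- The full prefix product is `immMatrix`. [cite: AndrewsForbes2022, Cor. 3.10 (proof)] -/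
theorem immPrefix_last (w e : ℕ) : immPrefix F w e e = immMatrix (Fin w) (e + 1) F := by
  rw [immMatrix_eq_prod, immPrefix, List.take_of_length_le]
  simp

/-- The labels respect the layering. [cite: AndrewsForbes2022, Cor. 3.10 (proof)] -/
theorem immLabel_layer (w e : ℕ) [NeZero w] (u v : IMMVtx w e) (h : immLabel F w e u v ≠ 0) :
    immLayer w e v = immLayer w e u + 1 := by
  rcases u with _ | ⟨i, j⟩ | _ <;> rcases v with _ | ⟨i', j'⟩ | _ <;>
    simp_all [immLabel, immLayer]


/-- The labels are affine-linear (single variables). [cite: AndrewsForbes2022, Cor. 3.10 (proof)] -/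
theorem totalDegree_immLabel_le (w e : ℕ) [NeZero w] (u v : IMMVtx w e) :
    (immLabel F w e u v).totalDegree ≤ 1 := by
  rcases u with _ | ⟨i, j⟩ | _ <;> rcases v with _ | ⟨i', j'⟩ | _ <;>
    simp only [immLabel] <;> (try split_ifs) <;> simp [totalDegree_X]

/-- The source vertex. [cite: AndrewsForbes2022, Cor. 3.10 (proof)] -/
abbrev immSrc (w e : ℕ) : IMMVtx w e := Sum.inl ()
/-- The sink vertex. [cite: AndrewsForbes2022, Cor. 3.10 (proof)] -/
abbrev immSnk (w e : ℕ) : IMMVtx w e := Sum.inr (Sum.inr ())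
/-- A middle vertex `(i, j)`: vertex `j` of layer `i + 1`. [cite: AndrewsForbes2022, Cor. 3.10 (proof)] -/
abbrev immMid (w e : ℕ) (i : Fin e) (j : Fin w) : IMMVtx w e := Sum.inr (Sum.inl (i, j))

/-- One step of the path sum: `(N^(k+1)) s v = Σ_u (N^k) s u · N u v`, split over the three kinds of
vertices. [cite: AndrewsForbes2022, Cor. 3.10 (proof)] -/
theorem immPow_succ_apply (w e : ℕ) [NeZero w] (k : ℕ) (v : IMMVtx w e) :
    ((Matrix.of (immLabel F w e)) ^ (k + 1)) (immSrc w e) v =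
      ((Matrix.of (immLabel F w e)) ^ k) (immSrc w e) (immSrc w e) * immLabel F w e (immSrc w e) v +
      (∑ p : Fin e × Fin w, ((Matrix.of (immLabel F w e)) ^ k) (immSrc w e) (immMid w e p.1 p.2) *
          immLabel F w e (immMid w e p.1 p.2) v) +
      ((Matrix.of (immLabel F w e)) ^ k) (immSrc w e) (immSnk w e) * immLabel F w e (immSnk w e) v := by
  rw [pow_succ, Matrix.mul_apply, Fintype.sum_sum_type, Fintype.sum_sum_type]
  simp [add_assoc]

/-- No edge leaves the sink. [cite: AndrewsForbes2022, Cor. 3.10 (proof)] -/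
@[simp] theorem immLabel_snk (w e : ℕ) [NeZero w] (v : IMMVtx w e) :
    immLabel F w e (immSnk w e) v = 0 := by
  rcases v with _ | ⟨i', j'⟩ | _ <;> rfl

/-- The invariant: after `i + 1` steps the source reaches the middle vertex `(i, j)` with the
`(0, j)` entry of `X^{(0)} ⋯ X^{(i)}`. [cite: AndrewsForbes2022, Cor. 3.10 (proof)] -/
theorem immPow_mid (w e : ℕ) [NeZero w] :
    ∀ (i : ℕ) (hi : i < e) (j : Fin w),
      ((Matrix.of (immLabel F w e)) ^ (i + 1)) (immSrc w e) (immMid w e ⟨i, hi⟩ j) =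
        immPrefix F w e i 0 j := by
  intro i
  induction i with
  | zero =>
    intro hi j
    rw [immPow_succ_apply, immPrefix_zero, immFactor_apply]
    simp [immLabel]
  | succ i ih =>
    intro hi j'
    rw [immPow_succ_apply, immPrefix_succ _ _ _ (by omega), Matrix.mul_apply]
    have hs : immLabel F w e (immSrc w e) (immMid w e ⟨i + 1, hi⟩ j') = 0 := by
      simp [immLabel]
    rw [hs, mul_zero, zero_add, immLabel_snk, mul_zero, add_zero, Fintype.sum_prod_type]
    rw [Finset.sum_eq_single (⟨i, by omega⟩ : Fin e)]
    · refine Finset.sum_congr rfl fun j _ => ?_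
      rw [ih (by omega) j, immFactor_apply]
      simp [immLabel]
    · intro i'' _ hi''
      refine Finset.sum_eq_zero fun j _ => ?_
      have : immLabel F w e (immMid w e i'' j) (immMid w e ⟨i + 1, hi⟩ j') = 0 := by
        have hne : ¬ (i : ℕ) = (i'' : ℕ) := by
          intro h; apply hi''; ext; simp; omega
        simp [immLabel, hne]
      rw [this, mul_zero]
    · intro h; exact absurd (Finset.mem_univ _) h

/-- The final step: `(N^(e+1)) s t = (X^{(0)} ⋯ X^{(e)})_{0,0} = IMM_{w,e+1}`. [cite: AndrewsForbes2022, Cor. 3.10 (proof)] -/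
theorem immPow_snk (w e : ℕ) [NeZero w] :
    ((Matrix.of (immLabel F w e)) ^ (e + 1)) (immSrc w e) (immSnk w e) = imm11Poly w (e + 1) F := by
  rw [imm11Poly, ← immPrefix_last, immPow_succ_apply, immLabel_snk, mul_zero, add_zero]
  rcases Nat.eq_zero_or_pos e with he | he
  · subst he
    rw [immPrefix_zero, immFactor_apply]
    simp [immLabel]
  · obtain ⟨e', rfl⟩ := Nat.exists_eq_add_one_of_ne_zero he.ne'
    have hs : immLabel F w (e' + 1) (immSrc w (e' + 1)) (immSnk w (e' + 1)) = 0 := by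
      simp [immLabel]
    rw [hs, mul_zero, zero_add, immPrefix_succ _ _ _ (by omega), Matrix.mul_apply,
      Fintype.sum_prod_type, Finset.sum_eq_single (Fin.last e')]
    · refine Finset.sum_congr rfl fun j _ => ?_
      rw [show (immMid w (e' + 1) (Fin.last e') j) = immMid w (e' + 1) ⟨e', by omega⟩ j from rfl,
        immPow_mid _ _ e' (by omega) j, immFactor_apply]
      have hl : (⟨e' + 1, by omega⟩ : Fin (e' + 1 + 1)) = Fin.last (e' + 1) := rfl
      simp [immLabel, hl]
    · intro i'' _ hi''
      refine Finset.sum_eq_zero fun j _ => ?_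
      have : immLabel F w (e' + 1) (immMid w (e' + 1) i'' j) (immSnk w (e' + 1)) = 0 := by
        have hne : ¬ (i'' : ℕ) = e' := by
          intro h; apply hi''; ext; simp [Fin.val_last]; omega
        simp [immLabel, hne]
      rw [this, mul_zero]
    · intro h; exact absurd (Finset.mem_univ _) h

/-- **`IMM_{w,d}` is computed by a layered ABP on `w(d-1)+2` vertices** ("It is clear that
`IMM_{w,d}(y)` is computable by a layered algebraic branching program on `w(d-1)+2 ≤ r` vertices",
p0024:L88). [cite: AndrewsForbes2022, Cor. 3.10 (proof)] -/
theorem layeredABPComputes_imm11Poly (w d : ℕ) [NeZero w] :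
    LayeredABPComputes (w * (d - 1) + 2) (imm11Poly w d F) := by
  rcases d with _ | e
  · refine ⟨1, by omega, fun _ => 0, 0, 0, 0, ?_, ?_, ?_⟩
    · intro u v h; exact absurd rfl h
    · intro u v; simp
    · simp
  · have hcard : Fintype.card (IMMVtx w e) ≤ w * (e + 1 - 1) + 2 := by
      simp only [Fintype.card_sum, Fintype.card_unit, Fintype.card_prod, Fintype.card_fin]
      rw [Nat.add_sub_cancel, Nat.mul_comm]
      omega
    have h := layeredABPComputes_of_fintype (R := F) hcard (immLayer w e) (immSrc w e) (immSnk w e)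
      (Matrix.of (immLabel F w e)) (fun u v huv => immLabel_layer w e u v huv)
      (fun u v => totalDegree_immLabel_le w e u v)
    have hL : immLayer w e (immSnk w e) - immLayer w e (immSrc w e) = e + 1 := rfl
    rw [hL, immPow_snk] at h
    exact h

/-- **Corollary 3.10 from Theorem 3.8** (the printed proof, now with its ABP ingredient proved):
`AndrewsForbes2022_cor_3_10` holds conditionally on the named fact `AndrewsForbes2022_thm_3_8`.
[cite: AndrewsForbes2022, Cor. 3.10] -/
theorem AndrewsForbes2022_cor_3_10_of_thm_3_8 (h38 : AndrewsForbes2022_thm_3_8) :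
    AndrewsForbes2022_cor_3_10 :=
  AndrewsForbes2022_cor_3_10_of h38 fun F _ w d _ => layeredABPComputes_imm11Poly (F := F) w d

end IMMABP



/-! ### Proof of Lemma 3.6 [Valiant 1979]: `AndrewsForbes2022_lemma_3_6_holds` -/

namespace Lemma36

variable {S : Type u} [CommRing S] {V : Type} [Fintype V] [DecidableEq V]

/-- Powers of a layered adjacency matrix move exactly `i` layers (all `s–t` paths of a layered graph have the same length, p0022:L59). [cite: AndrewsForbes2022, Lemma 3.6 (proof)] -/
theorem pow_apply_ne_zero_layer (layer : V → ℕ) (N : Matrix V V S)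
    (h1 : ∀ u v, N u v ≠ 0 → layer v = layer u + 1) :
    ∀ (i : ℕ) (u v : V), (N ^ i) u v ≠ 0 → layer v = layer u + i := by
  intro i
  induction i with
  | zero =>
    intro u v h
    rw [pow_zero, Matrix.one_apply] at h
    by_cases huv : u = v
    · subst huv; simp
    · exact absurd (if_neg huv) h
  | succ i ih =>
    intro u v h
    rw [pow_succ, Matrix.mul_apply] at h
    obtain ⟨w, -, hw⟩ := Finset.exists_ne_zero_of_sum_ne_zero h
    have hw1 : (N ^ i) u w ≠ 0 := fun h0 => hw (by rw [h0, zero_mul])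
    have hw2 : N w v ≠ 0 := fun h0 => hw (by rw [h0, mul_zero])
    rw [h1 w v hw2, ih u w hw1]
    ring

/-- The pruned adjacency matrix: keep only the edges `u → v` with `layer u < L₀` and `layer v ≤ L₀` (the vertices beyond the sink's layer are made isolated; they do not lie on `s–t` paths). [cite: AndrewsForbes2022, Lemma 3.6 (proof)] -/
def prune (layer : V → ℕ) (L₀ : ℕ) (N : Matrix V V S) : Matrix V V S :=
  Matrix.of fun u v => if layer u < L₀ ∧ layer v ≤ L₀ then N u v else 0

omit [Fintype V] [DecidableEq V] in
/-- Pruning keeps every edge into a vertex of layer `≤ L₀`. [cite: AndrewsForbes2022, Lemma 3.6 (proof)] -/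
theorem prune_apply_of_le (layer : V → ℕ) (L₀ : ℕ) (N : Matrix V V S)
    (h1 : ∀ u v, N u v ≠ 0 → layer v = layer u + 1) (w v : V) (hv : layer v ≤ L₀) :
    prune layer L₀ N w v = N w v := by
  simp only [prune, Matrix.of_apply]
  split_ifs with h
  · rfl
  · by_contra hne
    have hne' : N w v ≠ 0 := fun h0 => hne (h0 ▸ rfl)
    have := h1 w v hne'
    exact h ⟨by omega, hv⟩

/-- Pruning does not change the path sums into vertices of layer `≤ L₀`. [cite: AndrewsForbes2022, Lemma 3.6 (proof)] -/
theorem prune_pow_apply (layer : V → ℕ) (L₀ : ℕ) (N : Matrix V V S)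
    (h1 : ∀ u v, N u v ≠ 0 → layer v = layer u + 1) :
    ∀ (i : ℕ) (u v : V), layer v ≤ L₀ → (prune layer L₀ N ^ i) u v = (N ^ i) u v := by
  intro i
  induction i with
  | zero => intro u v _; simp
  | succ i ih =>
    intro u v hv
    rw [pow_succ, pow_succ, Matrix.mul_apply, Matrix.mul_apply]
    refine Finset.sum_congr rfl fun w _ => ?_
    rw [prune_apply_of_le layer L₀ N h1 w v hv]
    by_cases hw : N w v = 0
    · rw [hw, mul_zero, mul_zero]
    · have hlw : layer w ≤ L₀ := by have := h1 w v hw; omega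
      rw [ih u w hlw]

omit [Fintype V] [DecidableEq V] in
/-- Edges of the pruned matrix. [cite: AndrewsForbes2022, Lemma 3.6 (proof)] -/
theorem prune_ne_zero (layer : V → ℕ) (L₀ : ℕ) (N : Matrix V V S) {u v : V}
    (h : prune layer L₀ N u v ≠ 0) : layer u < L₀ ∧ layer v ≤ L₀ ∧ N u v ≠ 0 := by
  simp only [prune, Matrix.of_apply] at h
  split_ifs at h with hc
  · exact ⟨hc.1, hc.2, h⟩
  · exact absurd rfl h

/-- Block-diagonal padding (isolated vertices) commutes with powers. [cite: AndrewsForbes2022, Lemma 3.6 (proof)] -/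
theorem fromBlocks_zero_pow {k l : Type} [Fintype k] [Fintype l] [DecidableEq k] [DecidableEq l]
    (A : Matrix k k S) (D : Matrix l l S) (i : ℕ) :
    (Matrix.fromBlocks A 0 0 D) ^ i = Matrix.fromBlocks (A ^ i) 0 0 (D ^ i) := by
  induction i with
  | zero => simp [Matrix.fromBlocks_one]
  | succ i ih => rw [pow_succ, ih, Matrix.fromBlocks_multiply]; simp [pow_succ]

/-- Strictly upper triangular adjacency matrices on `Fin n` move at least `p` positions in `p`
steps. [cite: AndrewsForbes2022, Lemma 3.6 (proof)] -/
theorem pow_apply_eq_zero_of_lt {n : ℕ} (N : Matrix (Fin n) (Fin n) S)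
    (hN : ∀ i j, N i j ≠ 0 → i < j) :
    ∀ (p : ℕ) (i j : Fin n), (N ^ p) i j ≠ 0 → (i : ℕ) + p ≤ j := by
  intro p
  induction p with
  | zero =>
    intro i j h
    rw [pow_zero, Matrix.one_apply] at h
    by_cases hij : i = j
    · subst hij; simp
    · exact absurd (if_neg hij) h
  | succ p ih =>
    intro i j h
    rw [pow_succ, Matrix.mul_apply] at h
    obtain ⟨w, -, hw⟩ := Finset.exists_ne_zero_of_sum_ne_zero h
    have hw1 : (N ^ p) i w ≠ 0 := fun h0 => hw (by rw [h0, zero_mul])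
    have hw2 : N w j ≠ 0 := fun h0 => hw (by rw [h0, mul_zero])
    have := ih i w hw1
    have := hN w j hw2
    omega

/-- … hence their `n`-th power vanishes (the graph is acyclic). [cite: AndrewsForbes2022, Lemma 3.6 (proof)] -/
theorem pow_card_eq_zero {n : ℕ} (N : Matrix (Fin n) (Fin n) S)
    (hN : ∀ i j, N i j ≠ 0 → i < j) : N ^ n = 0 := by
  ext i j
  by_contra h
  have := pow_apply_eq_zero_of_lt N hN n i j h
  have := j.isLt
  omega


/-! #### Unitriangular matrices on `Fin n` -/

/-- An upper unitriangular matrix (zero below the diagonal, ones on it) has leading principal minors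
`1` ("`A(G)_{[k],[k]}` is upper-triangular with ones along the diagonal. Thus `det = 1`", p0022:L95).
[cite: AndrewsForbes2022, Lemma 3.6 (proof)] -/
theorem det_submatrix_castLE_eq_one_of_unitriangular {n : ℕ} (M : Matrix (Fin n) (Fin n) S)
    (hlow : ∀ i j, j < i → M i j = 0) (hdiag : ∀ i, M i i = 1) {k' : ℕ} (hk' : k' ≤ n) :
    (M.submatrix (Fin.castLE hk') (Fin.castLE hk')).det = 1 := by
  rw [Matrix.det_of_upperTriangular]
  · simp [hdiag]
  · intro i j hij
    exact hlow _ _ hij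

/-- … and determinant `1`. [cite: AndrewsForbes2022, Lemma 3.6 (proof)] -/
theorem det_eq_one_of_unitriangular {n : ℕ} (M : Matrix (Fin n) (Fin n) S)
    (hlow : ∀ i j, j < i → M i j = 0) (hdiag : ∀ i, M i i = 1) : M.det = 1 := by
  have := det_submatrix_castLE_eq_one_of_unitriangular M hlow hdiag le_rfl
  have he : (Fin.castLE (le_refl n)) = id := by funext i; simp
  simpa [he] using this

/-! #### The corner update `A = (1 - N) + E_{t,s}` -/

/-- For a strictly upper triangular `N` on `Fin (n+1)`, the matrix `1 - N` with an extra `+1` in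
position `(last, s)` (the back edge `t → s` of the printed proof, with `t` placed last and self-loops
on the diagonal) has determinant `1 + Σ_{q ≤ n} (N^q) s last` = `1 +` (sum of the `s–t` path
weights): `det` is additive in the last row, `det (1 - N) = 1`, and the cofactor is
`adj(1 - N)_{s,last} = (Σ_q N^q)_{s,last}` since `(1 - N) Σ_q N^q = 1 - N^{n+1} = 1`. [cite: AndrewsForbes2022, Lemma 3.6 (proof)] -/
theorem corner_det {n : ℕ} (N : Matrix (Fin (n + 1)) (Fin (n + 1)) S)
    (hN : ∀ i j, N i j ≠ 0 → i < j) (s : Fin (n + 1)) :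
    ((1 - N).updateRow (Fin.last n) ((1 - N) (Fin.last n) + Pi.single s 1)).det =
      1 + ∑ q ∈ Finset.range (n + 1), (N ^ q) s (Fin.last n) := by
  set M : Matrix (Fin (n + 1)) (Fin (n + 1)) S := 1 - N with hM
  have hlow : ∀ i j, j < i → M i j = 0 := by
    intro i j hij
    have hN0 : N i j = 0 := by
      by_contra h; have := hN i j h; exact lt_asymm hij this
    simp [hM, hN0, (ne_of_gt hij)]
  have hdiag : ∀ i, M i i = 1 := by
    intro i
    have hN0 : N i i = 0 := by
      by_contra h; exact lt_irrefl _ (hN i i h)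
    simp [hM, hN0]
  have hdetM : M.det = 1 := det_eq_one_of_unitriangular M hlow hdiag
  -- geometric series inverse
  set T : Matrix (Fin (n + 1)) (Fin (n + 1)) S := ∑ q ∈ Finset.range (n + 1), N ^ q with hT
  have hMT : M * T = 1 := by
    rw [hM, hT, mul_neg_geom_sum, pow_card_eq_zero N hN, sub_zero]
  have hadj : M.adjugate = T := by
    have h1 : M⁻¹ = M.adjugate :=
      Matrix.inv_eq_right_inv (by rw [Matrix.mul_adjugate, hdetM, one_smul])
    have h2 : M⁻¹ = T := Matrix.inv_eq_right_inv hMT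
    rw [← h1, h2]
  rw [Matrix.det_updateRow_add, Matrix.updateRow_eq_self, hdetM, ← Matrix.adjugate_apply, hadj, hT,
    Matrix.sum_apply]


/-- The corner matrix `(1 - N) + E_{last,s}` (Valiant's `A(G)`: minus adjacency with unit diagonal and the back edge). [cite: AndrewsForbes2022, Lemma 3.6 (proof)] -/
def cornerMatrix {n : ℕ} (N : Matrix (Fin (n + 1)) (Fin (n + 1)) S) (s : Fin (n + 1)) :
    Matrix (Fin (n + 1)) (Fin (n + 1)) S :=
  (1 - N).updateRow (Fin.last n) ((1 - N) (Fin.last n) + Pi.single s 1)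

/-- Determinant of the corner matrix. [cite: AndrewsForbes2022, Lemma 3.6 (proof)] -/
theorem cornerMatrix_det {n : ℕ} (N : Matrix (Fin (n + 1)) (Fin (n + 1)) S)
    (hN : ∀ i j, N i j ≠ 0 → i < j) (s : Fin (n + 1)) :
    (cornerMatrix N s).det = 1 + ∑ q ∈ Finset.range (n + 1), (N ^ q) s (Fin.last n) :=
  corner_det N hN s

/-- Proper leading principal minors of the corner matrix are `1` (they omit the last row). [cite: AndrewsForbes2022, Lemma 3.6 (proof)] -/
theorem cornerMatrix_minor {n : ℕ} (N : Matrix (Fin (n + 1)) (Fin (n + 1)) S)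
    (hN : ∀ i j, N i j ≠ 0 → i < j) (s : Fin (n + 1)) {k' : ℕ} (hk' : k' < n + 1) :
    ((cornerMatrix N s).submatrix (Fin.castLE hk'.le) (Fin.castLE hk'.le)).det = 1 := by
  have hrow : ∀ i : Fin k', Fin.castLE hk'.le i ≠ Fin.last n := by
    intro i h
    have := congrArg Fin.val h
    simp only [Fin.val_castLE, Fin.val_last] at this
    omega
  have hsub : (cornerMatrix N s).submatrix (Fin.castLE hk'.le) (Fin.castLE hk'.le) =
      (1 - N).submatrix (Fin.castLE hk'.le) (Fin.castLE hk'.le) := by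
    ext i j
    simp only [cornerMatrix, Matrix.submatrix_apply, Matrix.updateRow_ne (hrow i)]
  rw [hsub]
  refine det_submatrix_castLE_eq_one_of_unitriangular _ ?_ ?_ hk'.le
  · intro i j hij
    have hN0 : N i j = 0 := by by_contra h; exact lt_asymm hij (hN i j h)
    simp [hN0, ne_of_gt hij]
  · intro i
    have hN0 : N i i = 0 := by by_contra h; exact lt_irrefl _ (hN i i h)
    simp [hN0]

/-- Entries of the corner matrix are affine-linear when those of `N` are. [cite: AndrewsForbes2022, Lemma 3.6 (proof)] -/
theorem cornerMatrix_totalDegree {n : ℕ} {ι : Type} {R : Type} [CommRing R]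
    (N : Matrix (Fin (n + 1)) (Fin (n + 1)) (MvPolynomial ι R))
    (hN : ∀ i j, (N i j).totalDegree ≤ 1) (s : Fin (n + 1)) (i j : Fin (n + 1)) :
    (cornerMatrix N s i j).totalDegree ≤ 1 := by
  have hM : ∀ i j, ((1 - N) i j).totalDegree ≤ 1 := by
    intro i j
    rw [Matrix.sub_apply]
    refine (totalDegree_sub _ _).trans (max_le ?_ (hN i j))
    rw [Matrix.one_apply]; split_ifs <;> simp
  unfold cornerMatrix
  by_cases hi : i = Fin.last n
  · subst hi
    rw [Matrix.updateRow_self, Pi.add_apply]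
    refine (totalDegree_add _ _).trans (max_le (hM _ _) ?_)
    rw [Pi.single_apply]; split_ifs <;> simp
  · rw [Matrix.updateRow_ne hi]; exact hM i j

/-- The main case of Lemma 3.6 (`layer s < layer t`): prune the ABP above the sink, pad with
`m - k` isolated vertices, sort the vertices by layer with the sink LAST (`Tuple.sort` of a key that
is strictly increasing along edges and maximal at the sink), and take the corner matrix. [cite: AndrewsForbes2022, Lemma 3.6 (proof)] -/
theorem main_case {R : Type} [CommRing R] {ι : Type} {m' k : ℕ} (hk : k ≤ m' + 1)
    (layer : Fin k → ℕ) (s t : Fin k) (N : Matrix (Fin k) (Fin k) (MvPolynomial ι R))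
    (h1 : ∀ u v, N u v ≠ 0 → layer v = layer u + 1) (h2 : ∀ u v, (N u v).totalDegree ≤ 1)
    (hst : layer s < layer t) :
    ∃ A : Matrix (Fin (m' + 1)) (Fin (m' + 1)) (MvPolynomial ι R),
      (∀ i j, (A i j).totalDegree ≤ 1) ∧ A.det = 1 + (N ^ (layer t - layer s)) s t ∧
        ∀ (k' : ℕ) (hk' : k' < m' + 1),
          (A.submatrix (Fin.castLE hk'.le) (Fin.castLE hk'.le)).det = 1 := by
  -- prune, pad, sort
  let N0 : Matrix (Fin k) (Fin k) (MvPolynomial ι R) := prune layer (layer t) N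
  let κ : Fin k → ℕ := fun v => if v = t then layer t + 2 else min (layer v) (layer t) + 1
  let B : Matrix (Fin k ⊕ Fin (m' + 1 - k)) (Fin k ⊕ Fin (m' + 1 - k)) (MvPolynomial ι R) :=
    Matrix.fromBlocks N0 0 0 0
  let κB : Fin k ⊕ Fin (m' + 1 - k) → ℕ := Sum.elim κ fun _ => 0
  let e : Fin k ⊕ Fin (m' + 1 - k) ≃ Fin (m' + 1) :=
    finSumFinEquiv.trans (finCongr (Nat.add_sub_cancel' hk))
  let κp : Fin (m' + 1) → ℕ := κB ∘ e.symm
  let p : Equiv.Perm (Fin (m' + 1)) := Tuple.sort κp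
  let E : Fin k ⊕ Fin (m' + 1 - k) ≃ Fin (m' + 1) := e.trans p.symm
  let Ns : Matrix (Fin (m' + 1)) (Fin (m' + 1)) (MvPolynomial ι R) := Matrix.reindex E E B
  have hEsymm : ∀ i, E.symm i = e.symm (p i) := fun i => rfl
  have hmono : Monotone (κp ∘ p) := Tuple.monotone_sort κp
  have hκE : ∀ i, κB (E.symm i) = (κp ∘ p) i := fun i => rfl
  have hlt_of_κ : ∀ i j, κB (E.symm i) < κB (E.symm j) → i < j := by
    intro i j h
    by_contra hij
    push Not at hij
    have := hmono hij
    rw [← hκE, ← hκE] at this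
    omega
  have hNs_apply : ∀ i j, Ns i j = B (E.symm i) (E.symm j) := fun i j => rfl
  have hNs_lt : ∀ i j, Ns i j ≠ 0 → i < j := by
    intro i j h
    rw [hNs_apply] at h
    apply hlt_of_κ
    rcases hx : E.symm i with u | u <;> rcases hy : E.symm j with v | v <;> rw [hx, hy] at h
    · simp only [B, Matrix.fromBlocks_apply₁₁] at h
      obtain ⟨hu, hv, huv⟩ := prune_ne_zero layer (layer t) N h
      have hl := h1 u v huv
      have hut : u ≠ t := fun h' => by subst h'; omega
      simp only [κB, Sum.elim_inl, κ, if_neg hut]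
      split_ifs with hvt <;> omega
    · simp [B] at h
    · simp [B] at h
    · simp [B] at h
  have hts : E (Sum.inl t) = Fin.last m' := by
    have hle : E (Sum.inl t) ≤ Fin.last m' := Fin.le_last _
    have hm := hmono hle
    rw [← hκE, ← hκE, Equiv.symm_apply_apply] at hm
    have hkt : κB (Sum.inl t) = layer t + 2 := by simp [κB, κ]
    have huniq : ∀ x, layer t + 2 ≤ κB x → x = Sum.inl t := by
      rintro (v | v) hx
      · simp only [κB, Sum.elim_inl, κ] at hx
        split_ifs at hx with hvt
        · rw [hvt]
        · omega
      · simp [κB] at hx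
    have hx := huniq _ (hkt ▸ hm)
    rw [← hx, Equiv.apply_symm_apply]
  have hpow : ∀ q, (Ns ^ q) (E (Sum.inl s)) (E (Sum.inl t)) = (N ^ q) s t := by
    intro q
    have hre : Ns ^ q = Matrix.reindex E E (B ^ q) := by
      have := map_pow (Matrix.reindexAlgEquiv (MvPolynomial ι R) (MvPolynomial ι R) E) B q
      simpa [Matrix.coe_reindexAlgEquiv, Ns] using this.symm
    rw [hre, Matrix.reindex_apply, Matrix.submatrix_apply, Equiv.symm_apply_apply,
      Equiv.symm_apply_apply]
    simp only [B, fromBlocks_zero_pow, Matrix.fromBlocks_apply₁₁, N0]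
    exact prune_pow_apply layer (layer t) N h1 q s t le_rfl
  refine ⟨cornerMatrix Ns (E (Sum.inl s)), ?_, ?_, ?_⟩
  · -- affine entries
    refine cornerMatrix_totalDegree Ns (fun i j => ?_) _
    rw [hNs_apply]
    rcases E.symm i with u | u <;> rcases E.symm j with v | v
    · simp only [B, Matrix.fromBlocks_apply₁₁, N0, prune, Matrix.of_apply]
      split_ifs
      · exact h2 u v
      · simp
    all_goals simp [B]
  · -- determinant
    rw [cornerMatrix_det Ns hNs_lt, ← hts]
    congr 1
    simp_rw [hpow]
    have hvan : ∀ q, q ≠ layer t - layer s → (N ^ q) s t = 0 := by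
      intro q hq
      by_contra h
      have := pow_apply_ne_zero_layer layer N h1 q s t h
      omega
    by_cases hL : layer t - layer s < m' + 1
    · rw [Finset.sum_eq_single_of_mem (layer t - layer s) (Finset.mem_range.mpr hL)]
      intro q _ hq
      exact hvan q hq
    · rw [Finset.sum_eq_zero (fun q hq => hvan q (by have := Finset.mem_range.mp hq; omega))]
      rw [← hpow (layer t - layer s)]
      have hz : Ns ^ (layer t - layer s) = 0 := by
        obtain ⟨d, hd⟩ := Nat.exists_eq_add_of_le (show m' + 1 ≤ layer t - layer s by omega)
        rw [hd, pow_add, pow_card_eq_zero Ns hNs_lt, zero_mul]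
      simp [hz]
  · -- leading minors
    intro k' hk'
    exact cornerMatrix_minor Ns hNs_lt _ hk'

end Lemma36

/-- **Discharge of `AndrewsForbes2022_lemma_3_6`** ([Valiant 1979, Thm. 1] in matrix form, as in the
printed proof: order the vertices by layers with `t` last, take `A = (I - N) + E_{t,s}` — the
adjacency matrix of the ABP with a back edge `t → s` and self-loops — so that `det A = 1 + g` by the
unit upper-triangularity of `I - N` and `adj(I - N) = Σ N^q`, and every proper leading principal
submatrix is unit upper triangular; isolated padding vertices in front). [cite: AndrewsForbes2022, Lemma 3.6] -/
theorem AndrewsForbes2022_lemma_3_6_holds : AndrewsForbes2022_lemma_3_6 := by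
  intro R _ ι m g hg
  obtain ⟨k, hk, layer, s, t, N, h1, h2, h3⟩ := hg
  subst h3
  obtain ⟨m', rfl⟩ : ∃ m', m = m' + 1 := ⟨m - 1, by have := s.isLt; omega⟩
  by_cases hst : layer s < layer t
  · exact Lemma36.main_case hk layer s t N h1 h2 hst
  · push Not at hst
    have hL : layer t - layer s = 0 := by omega
    rw [hL, pow_zero]
    by_cases hse : s = t
    · subst hse
      rw [Matrix.one_apply_eq]
      refine ⟨Lemma36.cornerMatrix 0 (Fin.last m'), ?_, ?_, ?_⟩
      · exact Lemma36.cornerMatrix_totalDegree 0 (fun i j => by simp) _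
      · rw [Lemma36.cornerMatrix_det 0 (fun i j h => absurd rfl h), Finset.sum_range_succ',
          pow_zero, Matrix.one_apply_eq]
        simp
      · intro k' hk'
        exact Lemma36.cornerMatrix_minor 0 (fun i j h => absurd rfl h) _ hk'
    · rw [Matrix.one_apply_ne hse, add_zero]
      refine ⟨1, ?_, by simp, ?_⟩
      · intro i j
        rw [Matrix.one_apply]
        split_ifs <;> simp
      · intro k' hk'
        exact Lemma36.det_submatrix_castLE_eq_one_of_unitriangular 1
          (fun i j hij => by simp [ne_of_gt hij]) (fun i => by simp) hk'.le


/-! ### Proof of Lemma 4.3: `AndrewsForbes2022_lemma_4_3_holds`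

Following the printed proof (p0027:L18–L75): `M` is the interleaving-permutation conjugate of the
skew double `((0, A), (-Aᵀ, 0))`; its leading `2k × 2k` block is the same construction for
`A_{[k],[k]}`; and `Pf(M) = det A` by Lemma 2.27 applied to `M = (A ⊕ 1) J_{2n} (A ⊕ 1)ᵀ`
(interleaved) with `Pf(J_{2n}) = 1` — a shorter road than the printed Lemma 2.28 + sign count,
giving the sign `+` (so `e = 0`) for every `k`. Tree tools: `Literature.LinearAlgebra.Matrix.
pfaffian_mul_mul_transpose` (Lemma 2.27), `pfaffian_stdJ`, and the bridge `pfaffian_eq_matrixPfaffian`. -/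

namespace Lemma43

variable {n : ℕ}

/-- The interleaving `Fin n ⊕ Fin n ≃ Fin (2n)`: `inl a ↦ 2a`, `inr a ↦ 2a + 1` (the permutation `P` of the printed proof, p0027:L20). [cite: AndrewsForbes2022, Lemma 4.3 (proof)] -/
def ilv (n : ℕ) : Fin n ⊕ Fin n ≃ Fin (2 * n) where
  toFun := Sum.elim (fun a => ⟨2 * (a : ℕ), by omega⟩) (fun a => ⟨2 * (a : ℕ) + 1, by omega⟩)
  invFun v := if (v : ℕ) % 2 = 0 then Sum.inl ⟨(v : ℕ) / 2, by omega⟩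
    else Sum.inr ⟨(v : ℕ) / 2, by omega⟩
  left_inv x := by
    rcases x with a | a
    · have h : (2 * (a : ℕ)) % 2 = 0 := by omega
      simp only [Sum.elim_inl, h, ↓reduceIte, Sum.inl.injEq]
      ext; simp
    · have h : ¬ (2 * (a : ℕ) + 1) % 2 = 0 := by omega
      simp only [Sum.elim_inr, h, ↓reduceIte, Sum.inr.injEq]
      ext; simp only; omega
  right_inv v := by
    by_cases h : (v : ℕ) % 2 = 0
    · simp only [h, ↓reduceIte, Sum.elim_inl]
      ext; simp only; omega
    · simp only [h, ↓reduceIte, Sum.elim_inr]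
      ext; simp only; omega

/-- The inverse interleaving: parity and half. [cite: AndrewsForbes2022, Lemma 4.3 (proof)] -/
theorem ilv_symm_apply (v : Fin (2 * n)) :
    (ilv n).symm v = if (v : ℕ) % 2 = 0 then Sum.inl ⟨(v : ℕ) / 2, by omega⟩
      else Sum.inr ⟨(v : ℕ) / 2, by omega⟩ := rfl

/-- `inl a ↦ 2a`. [cite: AndrewsForbes2022, Lemma 4.3 (proof)] -/
@[simp] theorem ilv_inl (a : Fin n) : ((ilv n (Sum.inl a) : Fin (2 * n)) : ℕ) = 2 * a := rfl
/-- `inr a ↦ 2a + 1`. [cite: AndrewsForbes2022, Lemma 4.3 (proof)] -/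
@[simp] theorem ilv_inr (a : Fin n) : ((ilv n (Sum.inr a) : Fin (2 * n)) : ℕ) = 2 * a + 1 := rfl

/-- The inverse interleaving commutes with the initial-segment embeddings `[2k] ⊆ [2n]`, `[k] ⊆ [n]`. [cite: AndrewsForbes2022, Lemma 4.3 (proof)] -/
theorem ilv_symm_castLE {k : ℕ} (h : 2 * k ≤ 2 * n) (i : Fin (2 * k)) :
    (ilv n).symm (Fin.castLE h i) =
      Sum.map (Fin.castLE (by omega : k ≤ n)) (Fin.castLE (by omega : k ≤ n)) ((ilv k).symm i) := by
  simp only [ilv_symm_apply, Fin.val_castLE]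
  split_ifs <;> rfl

variable {R : Type*} [CommRing R]

/-- The skew double `((0, A), (-Aᵀ, 0))` (p0027:L18). [cite: AndrewsForbes2022, Lemma 4.3 (proof)] -/
def dbl (A : Matrix (Fin n) (Fin n) R) : Matrix (Fin n ⊕ Fin n) (Fin n ⊕ Fin n) R :=
  Matrix.fromBlocks 0 A (-Aᵀ) 0

/-- The interleaved skew double `P · ((0, A), (-Aᵀ, 0)) · Pᵀ`: the matrix `M` of Lemma 4.3 (p0027:L20). [cite: AndrewsForbes2022, Lemma 4.3 (proof)] -/
def ilM (A : Matrix (Fin n) (Fin n) R) : Matrix (Fin (2 * n)) (Fin (2 * n)) R :=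
  Matrix.reindex (ilv n) (ilv n) (dbl A)

/-- The congruence factor `B = A ⊕ 1`, interleaved (so that `M = B · J_{2n} · Bᵀ`; Lemma 2.27). [cite: AndrewsForbes2022, Lemma 4.3 (proof) and Lemma 2.27] -/
def ilB (A : Matrix (Fin n) (Fin n) R) : Matrix (Fin (2 * n)) (Fin (2 * n)) R :=
  Matrix.reindex (ilv n) (ilv n) (Matrix.fromBlocks A 0 0 1)

/-- The standard alternating form `((0, 1), (-1, 0))`, interleaved (= the tree's `stdJ (2n)`). [cite: AndrewsForbes2022, Lemma 4.3 (proof) and Lemma 2.27] -/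
def ilJ (n : ℕ) : Matrix (Fin (2 * n)) (Fin (2 * n)) R :=
  Matrix.reindex (ilv n) (ilv n) (Matrix.fromBlocks 0 1 (-1) 0)

/-- The skew double is the congruence `(A ⊕ 1) · ((0,1),(-1,0)) · (A ⊕ 1)ᵀ`. [cite: AndrewsForbes2022, Lemma 4.3 (proof)] -/
theorem dbl_eq_mul (A : Matrix (Fin n) (Fin n) R) :
    dbl A = Matrix.fromBlocks A 0 0 1 * Matrix.fromBlocks 0 1 (-1) 0 *
      (Matrix.fromBlocks A 0 0 (1 : Matrix (Fin n) (Fin n) R))ᵀ := by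
  simp [dbl, fromBlocks_transpose, fromBlocks_multiply]

/-- Reindexing along an equivalence is multiplicative. [cite: AndrewsForbes2022, Lemma 4.3 (proof)] -/
theorem reindex_mul_eq (e : Fin n ⊕ Fin n ≃ Fin (2 * n))
    (X Y : Matrix (Fin n ⊕ Fin n) (Fin n ⊕ Fin n) R) :
    Matrix.reindex e e (X * Y) = Matrix.reindex e e X * Matrix.reindex e e Y := by
  simp only [reindex_apply]
  exact (submatrix_mul_equiv X Y e.symm e.symm e.symm).symm

/-- `M = B · J_{2n} · Bᵀ`. [cite: AndrewsForbes2022, Lemma 4.3 (proof)] -/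
theorem ilM_eq (A : Matrix (Fin n) (Fin n) R) : ilM A = ilB A * ilJ n * (ilB A)ᵀ := by
  rw [ilM, dbl_eq_mul, reindex_mul_eq, reindex_mul_eq, ilB, ilJ, transpose_reindex]

/-- `det B = det A`. [cite: AndrewsForbes2022, Lemma 4.3 (proof)] -/
theorem det_ilB (A : Matrix (Fin n) (Fin n) R) : (ilB A).det = A.det := by
  rw [ilB, det_reindex_self, det_fromBlocks_zero₂₁, det_one, mul_one]

/-- Reindexing commutes with negation. [cite: AndrewsForbes2022, Lemma 4.3 (proof)] -/
theorem reindex_neg' (e : Fin n ⊕ Fin n ≃ Fin (2 * n)) (X : Matrix (Fin n ⊕ Fin n) (Fin n ⊕ Fin n) R) :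
    Matrix.reindex e e (-X) = -Matrix.reindex e e X := rfl

/-- `J_{2n}` (interleaved form) is skew-symmetric. [cite: AndrewsForbes2022, Lemma 4.3 (proof)] -/
theorem ilJ_transpose : (ilJ n : Matrix _ _ R)ᵀ = -ilJ n := by
  rw [ilJ, transpose_reindex, fromBlocks_transpose, ← reindex_neg', fromBlocks_neg]
  simp only [transpose_zero, transpose_one, transpose_neg, neg_zero, neg_neg]

/-- `J_{2n}` (interleaved form) has zero diagonal. [cite: AndrewsForbes2022, Lemma 4.3 (proof)] -/
theorem ilJ_apply_self (i : Fin (2 * n)) : (ilJ n : Matrix _ _ R) i i = 0 := by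
  simp only [ilJ, reindex_apply, submatrix_apply]
  rcases (ilv n).symm i with a | a <;> simp

/-- `M` is skew-symmetric. [cite: AndrewsForbes2022, Lemma 4.3 (proof)] -/
theorem ilM_transpose (A : Matrix (Fin n) (Fin n) R) : (ilM A)ᵀ = -ilM A := by
  rw [ilM, transpose_reindex, dbl, fromBlocks_transpose, ← reindex_neg', fromBlocks_neg]
  simp only [transpose_zero, transpose_neg, transpose_transpose, neg_zero, neg_neg]

/-- `M` has zero diagonal. [cite: AndrewsForbes2022, Lemma 4.3 (proof)] -/
theorem ilM_apply_self (A : Matrix (Fin n) (Fin n) R) (i : Fin (2 * n)) : ilM A i i = 0 := by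
  simp only [ilM, dbl, reindex_apply, submatrix_apply]
  rcases (ilv n).symm i with a | a <;> simp

/-- `ilJ n` is the tree's standard alternating matrix `Literature.LinearAlgebra.Matrix.stdJ (2n)` (cite-instead: its Pfaffian is the tree's `pfaffian_stdJ`). [cite: AndrewsForbes2022, Lemma 4.3 (proof) and Lemma 2.27] -/
theorem ilJ_eq_stdJ (n : ℕ) :
    (ilJ n : Matrix _ _ R) = Literature.LinearAlgebra.Matrix.stdJ (2 * n) := by
  ext i j
  obtain ⟨x, rfl⟩ := (ilv n).surjective i
  obtain ⟨y, rfl⟩ := (ilv n).surjective j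
  simp only [ilJ, reindex_apply, submatrix_apply, Equiv.symm_apply_apply,
    Literature.LinearAlgebra.Matrix.stdJ, Matrix.of_apply]
  rcases x with a | a <;> rcases y with b | b <;>
    simp only [fromBlocks_apply₁₁, fromBlocks_apply₁₂, fromBlocks_apply₂₁, fromBlocks_apply₂₂,
      Matrix.zero_apply, Matrix.one_apply, Matrix.neg_apply, ilv_inl, ilv_inr, Fin.ext_iff] <;>
    split_ifs <;> first | rfl | (exfalso; omega) | simp

/-- `Pf(J_{2n}) = 1` (the tree's `pfaffian_stdJ`). [cite: AndrewsForbes2022, Lemma 4.3 (proof)] -/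
theorem pfaffian_ilJ (n : ℕ) : Literature.LinearAlgebra.Matrix.pfaffian (ilJ n : Matrix _ _ R) = 1 := by
  rw [ilJ_eq_stdJ]
  exact Literature.LinearAlgebra.Matrix.pfaffian_stdJ (even_two_mul n)

/-- `Pf(M) = det A` — Lemma 2.27 (`Pf(B J Bᵀ) = det B · Pf J`, the tree's `pfaffian_mul_mul_transpose`) with `det B = det A`, `Pf J = 1`; the sign of Lemma 4.3 is `+` for this `M`. [cite: AndrewsForbes2022, Lemma 4.3 (proof)] -/
theorem pfaffian_ilM (A : Matrix (Fin n) (Fin n) R) :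
    Literature.LinearAlgebra.Matrix.pfaffian (ilM A) = A.det := by
  rw [ilM_eq, Literature.LinearAlgebra.Matrix.pfaffian_mul_mul_transpose _ _ ilJ_transpose
    ilJ_apply_self, det_ilB, pfaffian_ilJ, mul_one]

/-- Restricting the skew double along `Sum.map f f` is the skew double of the restriction. [cite: AndrewsForbes2022, Lemma 4.3 (proof)] -/
theorem dbl_submatrix {k : ℕ} (A : Matrix (Fin n) (Fin n) R) (f : Fin k → Fin n) :
    (dbl A).submatrix (Sum.map f f) (Sum.map f f) = dbl (A.submatrix f f) := by
  ext (a | a) (b | b) <;> simp [dbl]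

/-- The leading `2k × 2k` block of `ilM A` is `ilM` of the leading `k × k` block of `A` ("`M_{[2k],[2k]} = P · ((0, A_{[k]}), (-A_{[k]}ᵀ, 0)) · Pᵀ`", p0027:L60). [cite: AndrewsForbes2022, Lemma 4.3 (proof)] -/
theorem ilM_submatrix_castLE {k : ℕ} (A : Matrix (Fin n) (Fin n) R) (hk : k ≤ n) :
    (ilM A).submatrix (Fin.castLE (Nat.mul_le_mul_left 2 hk)) (Fin.castLE (Nat.mul_le_mul_left 2 hk)) =
      ilM (A.submatrix (Fin.castLE hk) (Fin.castLE hk)) := by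
  ext i j
  simp only [ilM, reindex_apply, submatrix_apply, ilv_symm_castLE]
  rw [← dbl_submatrix A (Fin.castLE hk), submatrix_apply]

end Lemma43

/-- **Discharge of `AndrewsForbes2022_lemma_4_3`** (Lemma 4.3, p0027:L15), following the printed
proof: `M` is the interleaving permutation-conjugate of the skew double `((0, A), (-Aᵀ, 0))`
(`Lemma43.ilM`), whose leading `2k × 2k` block is the same construction for `A_{[k],[k]}`; and
`Pf(ilM A) = det A` (sign `+`, so `e = 0` throughout) by the congruence `ilM A = B · J_{2n} · Bᵀ`
with `B = A ⊕ 1` interleaved and `J_{2n}` the standard alternating matrix, Lemma 2.27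
(`Pf(B A Bᵀ) = det B · Pf A`, the tree's `Literature.LinearAlgebra.Matrix.pfaffian_mul_mul_transpose`)
and `Pf(J_{2n}) = 1` (the tree's `pfaffian_stdJ`), via the bridge `pfaffian_eq_matrixPfaffian`.
[cite: AndrewsForbes2022, Lemma 4.3] -/
theorem AndrewsForbes2022_lemma_4_3_holds : AndrewsForbes2022_lemma_4_3 := by
  intro R _ n A
  refine ⟨Lemma43.ilM A, Lemma43.ilM_transpose A, Lemma43.ilM_apply_self A, fun k hk => ⟨0, ?_⟩⟩
  rw [pow_zero, one_mul, Lemma43.ilM_submatrix_castLE A hk, pfaffian_eq_matrixPfaffian,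
    Lemma43.pfaffian_ilM]

/-! ### Proof of Lemma 2.20: `AndrewsForbes2022_lemma_2_20_holds`

Following the printed proof (p0014:L117–p0015:L9): Taylor's formula `f(y + x) = Σ_a ∂/∂x^a(f) y^a`
(Def. 2.13 — proved here from the Lemma 2.14 definition of `mvHasseDeriv`: `Lemma220.coeff_taylor`),
the identity `(f ∘ A)(y + x) = f(Ay + Ax)` (`Lemma220.taylor_linSubst`), and coefficient extraction
(`Lemma220.coeff_linSubst₂`): every `∂/∂x^a (f(Ax))` is a linear combination of the
`(∂/∂x^b f)(Ax)` with `|b| = |a|`, the coefficients being those of the homogeneous `(Ay)^b`; hence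
`∂_{≤d}(f(Ax)) ⊆ (∂_{≤d} f)(Ax)` and the dimension drops at most; for invertible `A` apply this to
`A⁻¹`. By-products: additivity of `mvHasseDeriv`, finiteness of `{∂/∂x^a f}` and finite
dimensionality of `∂_{<∞}(f)`, `∂_{≤d}(f)`. -/

namespace Lemma220

variable {R : Type*} [CommSemiring R] {σ : Type*}

/-- The Taylor shift `f(x) ↦ f(y + x)`: outer variables `y = X`, inner coefficients `x = C (X ·)`
(Def. 2.13: `∂/∂x^a (f) := Coeff_{y^a}(f(x + y))`). [cite: AndrewsForbes2022, Def. 2.13] -/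
def taylor : MvPolynomial σ R →ₐ[R] MvPolynomial σ (MvPolynomial σ R) :=
  MvPolynomial.aeval fun i => X i + C (X i)

/-- `taylor (x_i) = y_i + x_i`. [cite: AndrewsForbes2022, Def. 2.13] -/
theorem taylor_X (i : σ) : taylor (X i : MvPolynomial σ R) = X i + C (X i) := by
  simp [taylor]

/-- `taylor` fixes constants. [cite: AndrewsForbes2022, Def. 2.13] -/
theorem taylor_C (c : R) : taylor (C c : MvPolynomial σ R) = C (C c) := by
  rw [taylor, aeval_C]; rfl

/-- Coefficients of `(y_i + x_i)^k`. [cite: AndrewsForbes2022, Lemma 2.20 (proof)] -/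
theorem coeff_X_add_C_pow [DecidableEq σ] (i : σ) (k : ℕ) (m : σ →₀ ℕ) :
    coeff m ((X i + C (X i) : MvPolynomial σ (MvPolynomial σ R)) ^ k) =
      if m = Finsupp.single i (m i) ∧ m i ≤ k then
        (k.choose (m i) : MvPolynomial σ R) * X i ^ (k - m i)
      else 0 := by
  rw [add_pow, coeff_sum]
  have hterm : ∀ j ∈ Finset.range (k + 1),
      coeff m ((X i : MvPolynomial σ (MvPolynomial σ R)) ^ j * C (X i) ^ (k - j) *
          (↑(k.choose j) : MvPolynomial σ (MvPolynomial σ R))) =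
        if Finsupp.single i j = m then (k.choose j : MvPolynomial σ R) * X i ^ (k - j) else 0 := by
    intro j _
    rw [← C_pow, ← map_natCast (C : MvPolynomial σ R →+* MvPolynomial σ (MvPolynomial σ R)),
      mul_assoc, ← map_mul, mul_comm, coeff_C_mul, coeff_X_pow]
    split_ifs <;> simp [mul_comm]
  rw [Finset.sum_congr rfl hterm]
  split_ifs with h
  · obtain ⟨hm, hk⟩ := h
    rw [Finset.sum_eq_single_of_mem (m i) (by simp; omega)]
    · rw [if_pos hm.symm]
    · intro j hj hne
      rw [if_neg]
      intro hji
      apply hne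
      have := congrArg (fun f => f i) hji
      simpa using this
  · refine Finset.sum_eq_zero fun j hj => ?_
    rw [if_neg]
    intro hji
    apply h
    have hi : m i = j := by rw [← hji]; simp
    refine ⟨?_, ?_⟩
    · rw [hi, hji]
    · simp at hj; omega

/-- The scalar bookkeeping of the inductive step: `∏_l binom((k e_i + b)_l, a_l) =
binom(k, a_i) ∏_{l ≠ i} binom(b_l, a_l)` when `b_i = 0`. [cite: AndrewsForbes2022, Lemma 2.20 (proof)] -/
theorem prod_choose_single_add [DecidableEq σ] (i : σ) (k : ℕ) (b a : σ →₀ ℕ) (hb : b i = 0) :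
    (a.prod fun l m => (((Finsupp.single i k + b) l).choose m : R)) =
      (k.choose (a i) : R) * (a.erase i).prod fun l m => ((b l).choose m : R) := by
  have hcongr : ((a.erase i).prod fun l m => (((Finsupp.single i k + b) l).choose m : R)) =
      (a.erase i).prod fun l m => ((b l).choose m : R) := by
    refine Finsupp.prod_congr fun l hl => ?_
    have hli : l ≠ i := by
      intro h; subst h; simp at hl
    simp [Ne.symm hli]
  by_cases hi : i ∈ a.support
  · rw [← Finsupp.mul_prod_erase a i _ hi, hcongr]
    simp [hb]
  · have ha : a i = 0 := by simpa using hi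
    rw [Finsupp.erase_of_notMem_support hi] at hcongr ⊢
    rw [hcongr, ha, Nat.choose_zero_right, Nat.cast_one, one_mul]

/-- The exponent bookkeeping of the inductive step. [cite: AndrewsForbes2022, Lemma 2.20 (proof)] -/
theorem single_add_tsub [DecidableEq σ] (i : σ) (k : ℕ) (b a : σ →₀ ℕ) (hb : b i = 0)
    (hk : a i ≤ k) :
    Finsupp.single i k + b - a = Finsupp.single i (k - a i) + (b - a.erase i) := by
  ext l
  by_cases hl : l = i
  · subst hl; simp [hb]
  · simp [Ne.symm hl, Finsupp.erase_ne hl]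

/-- **Taylor's formula for Hasse derivatives** on monomials:
`Coeff_{y^a} (y + x)^b = binom(b, a) x^{b - a}`. [cite: AndrewsForbes2022, Lemma 2.20 (proof)] -/
theorem coeff_taylor_monomial [DecidableEq σ] (b : σ →₀ ℕ) :
    ∀ a : σ →₀ ℕ, coeff a (taylor (monomial b (1 : R))) =
      monomial (b - a) (a.prod fun i k => ((b i).choose k : R)) := by
  induction b using Finsupp.induction with
  | zero =>
    intro a
    rw [← C_apply, taylor_C, C_1, C_1, coeff_one]
    by_cases ha : a = 0
    · subst ha; simp
    · rw [if_neg (Ne.symm ha)]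
      obtain ⟨l, hl⟩ : ∃ l, l ∈ a.support := by
        by_contra h
        push Not at h
        exact ha (Finsupp.support_eq_empty.mp (Finset.eq_empty_of_forall_notMem h))
      rw [Finsupp.prod, Finset.prod_eq_zero hl]
      · simp
      · have : a l ≠ 0 := by simpa using hl
        simp [Nat.choose_eq_zero_of_lt (Nat.pos_of_ne_zero this)]
  | single_add i k b hi hk ih =>
    intro a
    have hb : b i = 0 := by simpa using hi
    rw [monomial_single_add, map_mul, map_pow, taylor_X, coeff_mul]
    set p₀ : (σ →₀ ℕ) × (σ →₀ ℕ) := (Finsupp.single i (a i), a.erase i) with hp₀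
    rw [Finset.sum_eq_single p₀]
    · -- the main term
      rw [hp₀, coeff_X_add_C_pow, ih]
      simp only [Finsupp.single_eq_same, true_and]
      by_cases hak : a i ≤ k
      · rw [if_pos hak, ← map_natCast (C : R →+* MvPolynomial σ R), mul_assoc,
          ← monomial_single_add, C_mul_monomial, ← single_add_tsub i k b a hb hak,
          prod_choose_single_add i k b a hb]
      · rw [if_neg hak, zero_mul, prod_choose_single_add i k b a hb,
          Nat.choose_eq_zero_of_lt (Nat.lt_of_not_le hak), Nat.cast_zero, zero_mul, monomial_zero]
    · -- all other terms vanish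
      rintro ⟨p1, p2⟩ hp hne
      rw [Finset.HasAntidiagonal.mem_antidiagonal] at hp
      rw [coeff_X_add_C_pow]
      dsimp only at hp hne ⊢
      split_ifs with hc
      · rw [ih]
        by_cases hp2 : p2 i = 0
        · exfalso; apply hne
          have h1 : p1 i = a i := by
            have := congrArg (fun f => f i) hp
            simpa [hp2] using this
          rw [hp₀, Prod.mk.injEq]
          refine ⟨by rw [hc.1, h1], ?_⟩
          ext l
          by_cases hl : l = i
          · subst hl; simp [hp2]
          · have := congrArg (fun f => f l) hp
            simp only [Finsupp.coe_add, Pi.add_apply] at this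
            rw [hc.1, Finsupp.single_apply, if_neg (Ne.symm hl), zero_add] at this
            rw [Finsupp.erase_ne hl, ← this]
        · have hmem : i ∈ p2.support := by simpa using hp2
          rw [Finsupp.prod, Finset.prod_eq_zero hmem, monomial_zero, mul_zero]
          simp [hb, Nat.choose_eq_zero_of_lt (Nat.pos_of_ne_zero hp2)]
      · rw [zero_mul]
    · intro h
      exfalso; apply h
      rw [Finset.HasAntidiagonal.mem_antidiagonal, hp₀]
      exact Finsupp.single_add_erase i a

/-- `mvHasseDeriv a f` as a sum over any finite set containing the support of `f`. [cite: AndrewsForbes2022, Lemma 2.20 (proof)] -/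
theorem mvHasseDeriv_eq_sum_of_subset (a : σ →₀ ℕ) (f : MvPolynomial σ R) {S : Finset (σ →₀ ℕ)}
    (hS : f.support ⊆ S) :
    mvHasseDeriv a f =
      ∑ b ∈ S, monomial (b - a) ((a.prod fun i k => ((b i).choose k : R)) * coeff b f) := by
  unfold mvHasseDeriv
  exact Finset.sum_subset hS fun b _ hb => by simp [notMem_support_iff.mp hb]

/-- Hasse derivatives are additive. [cite: AndrewsForbes2022, Def. 2.13] -/
theorem mvHasseDeriv_add (a : σ →₀ ℕ) (p q : MvPolynomial σ R) :
    mvHasseDeriv a (p + q) = mvHasseDeriv a p + mvHasseDeriv a q := by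
  classical
  rw [mvHasseDeriv_eq_sum_of_subset a (p + q) (S := p.support ∪ q.support) support_add,
    mvHasseDeriv_eq_sum_of_subset a p Finset.subset_union_left,
    mvHasseDeriv_eq_sum_of_subset a q Finset.subset_union_right, ← Finset.sum_add_distrib]
  refine Finset.sum_congr rfl fun b _ => ?_
  rw [coeff_add, mul_add, map_add]

/-- **Taylor's formula** (Def. 2.13 ⟺ Lemma 2.14): the `y^a`-coefficient of `f(y + x)` is the
Hasse derivative `∂/∂x^a (f)`. [cite: AndrewsForbes2022, Def. 2.13 and Lemma 2.14] -/
theorem coeff_taylor [DecidableEq σ] (f : MvPolynomial σ R) (a : σ →₀ ℕ) :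
    coeff a (taylor f) = mvHasseDeriv a f := by
  induction f using MvPolynomial.induction_on' with
  | monomial u c =>
    have hu : (monomial u c : MvPolynomial σ R) = C c * monomial u 1 := by
      rw [C_mul_monomial, mul_one]
    rw [mvHasseDeriv_monomial, hu, map_mul, taylor_C, coeff_C_mul, coeff_taylor_monomial,
      C_mul_monomial, mul_comm]
  | add p q hp hq => rw [map_add, coeff_add, hp, hq, mvHasseDeriv_add]

/-- Only finitely many Hasse derivatives of `f` are nonzero: `∂/∂x^a (f) = 0` unless `a` is in the
support of `f(y + x)`. [cite: AndrewsForbes2022, Def. 2.13] -/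
theorem mvHasseDeriv_eq_zero_of_notMem [DecidableEq σ] (f : MvPolynomial σ R) {a : σ →₀ ℕ}
    (ha : a ∉ (taylor f).support) : mvHasseDeriv a f = 0 := by
  rw [← coeff_taylor]; exact notMem_support_iff.mp ha

/-- The set of all Hasse derivatives of `f` is finite. [cite: AndrewsForbes2022, Def. 2.19] -/
theorem finite_range_mvHasseDeriv (f : MvPolynomial σ R) :
    (Set.range fun a : σ →₀ ℕ => mvHasseDeriv a f).Finite := by
  classical
  refine (((taylor f).support.image fun b => coeff b (taylor f)).finite_toSet.union
    (Set.finite_singleton (0 : MvPolynomial σ R))).subset ?_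
  rintro _ ⟨a, rfl⟩
  by_cases ha : a ∈ (taylor f).support
  · left
    simp only [Finset.coe_image, Set.mem_image, Finset.mem_coe]
    exact ⟨a, ha, coeff_taylor f a⟩
  · right
    simp [mvHasseDeriv_eq_zero_of_notMem f ha]

/-! #### The linear substitution `x ↦ A x` and the chain rule -/

section LinSubst

variable [Fintype σ]

/-- The substitution `f(x) ↦ f(A x)`: `x_i ↦ Σ_j A i j • x_j`. [cite: AndrewsForbes2022, Lemma 2.20 (proof)] -/
def linSubst (A : Matrix σ σ R) : MvPolynomial σ R →ₐ[R] MvPolynomial σ R :=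
  MvPolynomial.aeval fun i => ∑ j, A i j • (X j : MvPolynomial σ R)

/-- `linSubst A (x_i) = Σ_j A i j • x_j`. [cite: AndrewsForbes2022, Lemma 2.20] -/
theorem linSubst_X (A : Matrix σ σ R) (i : σ) :
    linSubst A (X i) = ∑ j, A i j • (X j : MvPolynomial σ R) := by
  simp [linSubst]

/-- `f(A(Bx))`: composing substitutions multiplies the matrices. [cite: AndrewsForbes2022, Lemma 2.20 (proof)] -/
theorem linSubst_comp (A B : Matrix σ σ R) :
    (linSubst B).comp (linSubst A) = linSubst (A * B) := by
  refine MvPolynomial.algHom_ext fun i => ?_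
  rw [AlgHom.comp_apply, linSubst_X, map_sum, linSubst_X]
  simp_rw [map_smul, linSubst_X, Finset.smul_sum, smul_smul, Matrix.mul_apply, Finset.sum_smul]
  rw [Finset.sum_comm]

/-- The identity matrix substitutes trivially. [cite: AndrewsForbes2022, Lemma 2.20 (proof)] -/
theorem linSubst_one [DecidableEq σ] : linSubst (1 : Matrix σ σ R) = AlgHom.id R _ := by
  refine MvPolynomial.algHom_ext fun i => ?_
  rw [linSubst_X, AlgHom.id_apply]
  simp [Matrix.one_apply, ite_smul]

/-- The product of linear forms `∏_i (Σ_j A i j x_j)^{b_i}` — whose `y^a`-coefficients are the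
chain-rule coefficients. [cite: AndrewsForbes2022, Lemma 2.20 (proof)] -/
def linPow (A : Matrix σ σ R) (b : σ →₀ ℕ) : MvPolynomial σ R :=
  b.prod fun i k => (∑ j, A i j • (X j : MvPolynomial σ R)) ^ k

/-- A linear form is homogeneous of degree `1`. [cite: AndrewsForbes2022, Lemma 2.20 (proof)] -/
theorem isHomogeneous_lin (A : Matrix σ σ R) (i : σ) :
    (∑ j, A i j • (X j : MvPolynomial σ R)).IsHomogeneous 1 := by
  refine IsHomogeneous.sum Finset.univ (fun j => A i j • (X j : MvPolynomial σ R)) 1 fun j _ => ?_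
  rw [smul_eq_C_mul]
  exact isHomogeneous_C_mul_X (A i j) j

/-- `(Ay)^b` is homogeneous of degree `|b|` — so only derivatives of the same order occur in the chain rule ("for `a` with `|a| = k`, … a linear combination of `{∂f/∂x^b (Ax) : |b| = k}`", p0014:L120). [cite: AndrewsForbes2022, Lemma 2.20 (proof)] -/
theorem isHomogeneous_linPow (A : Matrix σ σ R) (b : σ →₀ ℕ) :
    (linPow A b).IsHomogeneous (Finsupp.degree b) := by
  have h := IsHomogeneous.prod b.support (fun i => (∑ j, A i j • (X j : MvPolynomial σ R)) ^ b i)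
    (fun i => b i) fun i _ => by simpa using (isHomogeneous_lin A i).pow (b i)
  have hdeg : Finsupp.degree b = ∑ i ∈ b.support, b i :=
    (Finsupp.degree_eq_sum b).trans
      (Finset.sum_subset (Finset.subset_univ _) fun i _ hi => Finsupp.notMem_support_iff.mp hi).symm
  rw [hdeg]
  exact h

/-- The substitution acting on `f(y + x)`: `x ↦ A x` on the inner coefficients, `y ↦ A y` on the
outer variables. [cite: AndrewsForbes2022, Lemma 2.20 (proof)] -/
def linSubst₂ (A : Matrix σ σ R) :
    MvPolynomial σ (MvPolynomial σ R) →+* MvPolynomial σ (MvPolynomial σ R) :=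
  eval₂Hom ((C : MvPolynomial σ R →+* MvPolynomial σ (MvPolynomial σ R)).comp
      (linSubst A).toRingHom)
    fun i => MvPolynomial.map (C : R →+* MvPolynomial σ R) (∑ j, A i j • (X j : MvPolynomial σ R))

/-- `linSubst` fixes constants. [cite: AndrewsForbes2022, Lemma 2.20] -/
theorem linSubst_C (A : Matrix σ σ R) (c : R) : linSubst A (C c) = C c := by
  simp [linSubst]

/-- `(f ∘ A)(y + x) = f(Ay + Ax)`. [cite: AndrewsForbes2022, Lemma 2.20 (proof)] -/
theorem taylor_linSubst (A : Matrix σ σ R) (f : MvPolynomial σ R) :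
    taylor (linSubst A f) = linSubst₂ A (taylor f) := by
  have : (taylor.comp (linSubst A)).toRingHom =
      (linSubst₂ A).comp (taylor : MvPolynomial σ R →ₐ[R] _).toRingHom := by
    refine MvPolynomial.ringHom_ext (fun c => ?_) (fun i => ?_)
    · show taylor (linSubst A (C c)) = linSubst₂ A (taylor (C c))
      rw [linSubst_C, taylor_C, linSubst₂, coe_eval₂Hom, eval₂_C, RingHom.comp_apply,
        AlgHom.toRingHom_eq_coe, RingHom.coe_coe, linSubst_C]
    · show taylor (linSubst A (X i)) = linSubst₂ A (taylor (X i))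
      rw [linSubst_X, taylor_X, linSubst₂, coe_eval₂Hom, eval₂_add, eval₂_X, eval₂_C,
        RingHom.comp_apply, AlgHom.toRingHom_eq_coe, RingHom.coe_coe, linSubst_X]
      simp only [map_sum, smul_eq_C_mul, map_mul, taylor_C, taylor_X, map_X, map_C, mul_add,
        Finset.sum_add_distrib]
  exact congrArg (fun φ : MvPolynomial σ R →+* _ => φ f) this

/-- Coefficient extraction after the double substitution: the `y^a`-coefficient of
`linSubst₂ A P` is `Σ_b Coeff_{y^a}((Ay)^b) · (coeff_b P)(Ax)`. [cite: AndrewsForbes2022, Lemma 2.20 (proof)] -/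
theorem coeff_linSubst₂ [DecidableEq σ] (A : Matrix σ σ R) (P : MvPolynomial σ (MvPolynomial σ R))
    (a : σ →₀ ℕ) :
    coeff a (linSubst₂ A P) = ∑ b ∈ P.support, coeff a (linPow A b) • linSubst A (coeff b P) := by
  rw [linSubst₂, coe_eval₂Hom, eval₂_eq, coeff_sum]
  refine Finset.sum_congr rfl fun b _ => ?_
  rw [RingHom.coe_comp, Function.comp_apply, coeff_C_mul]
  have : (∏ i ∈ b.support, (MvPolynomial.map (C : R →+* MvPolynomial σ R)
      (∑ j, A i j • (X j : MvPolynomial σ R))) ^ b i) =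
      MvPolynomial.map (C : R →+* MvPolynomial σ R) (linPow A b) := by
    rw [linPow, Finsupp.prod, map_prod]
    simp_rw [map_pow]
  rw [this, coeff_map, smul_eq_C_mul, mul_comm]
  rfl

end LinSubst

end Lemma220

/-! #### Lemma 2.20 -/

section Lemma220Main

open Lemma220

variable {F : Type*} [Field F]

/-- `∂_{<∞}(f)` is finite-dimensional. [cite: AndrewsForbes2022, Def. 2.19] -/
theorem finiteDimensional_partialSpace {σ : Type*} (f : MvPolynomial σ F) :
    FiniteDimensional F (partialSpace f) :=
  FiniteDimensional.span_of_finite F (finite_range_mvHasseDeriv f)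

/-- `∂_{≤d}(f)` is finite-dimensional. [cite: AndrewsForbes2022, Def. 2.19] -/
theorem finiteDimensional_partialSpaceLE {σ : Type*} (d : ℕ) (f : MvPolynomial σ F) :
    FiniteDimensional F (partialSpaceLE d f) :=
  haveI := finiteDimensional_partialSpace f
  Submodule.finiteDimensional_of_le (partialSpaceLE_le d f)

/-- **Chain rule for Hasse derivatives under `x ↦ A x`** (proof of Lemma 2.20, p0014:L120):
`∂_{≤d}(f(Ax)) ⊆ { g(Ax) : g ∈ ∂_{≤d}(f) }`. [cite: AndrewsForbes2022, Lemma 2.20 (proof)] -/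
theorem partialSpaceLE_linSubst_le {σ : Type*} [Fintype σ] (A : Matrix σ σ F) (d : ℕ)
    (f : MvPolynomial σ F) :
    partialSpaceLE d (linSubst A f) ≤ (partialSpaceLE d f).map (linSubst A).toLinearMap := by
  classical
  refine Submodule.span_le.mpr ?_
  rintro _ ⟨a, ha, rfl⟩
  show mvHasseDeriv a (linSubst A f) ∈ (partialSpaceLE d f).map (linSubst A).toLinearMap
  rw [← coeff_taylor, taylor_linSubst, coeff_linSubst₂]
  refine Submodule.sum_mem _ fun b _ => ?_
  by_cases hb : Finsupp.degree b = Finsupp.degree a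
  · refine Submodule.smul_mem _ _ (Submodule.mem_map_of_mem ?_)
    rw [coeff_taylor]
    exact Submodule.subset_span ⟨b, by simp only [Set.mem_setOf_eq] at ha ⊢; omega, rfl⟩
  · rw [(isHomogeneous_linPow A b).coeff_eq_zero (Ne.symm hb), zero_smul]
    exact Submodule.zero_mem _

/-- Lemma 2.20, first part, for any finite index type. [cite: AndrewsForbes2022, Lemma 2.20] -/
theorem finrank_partialSpaceLE_linSubst_le {σ : Type*} [Fintype σ] (A : Matrix σ σ F) (d : ℕ)
    (f : MvPolynomial σ F) :
    Module.finrank F (partialSpaceLE d (linSubst A f)) ≤ Module.finrank F (partialSpaceLE d f) := by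
  haveI := finiteDimensional_partialSpaceLE d f
  exact (Submodule.finrank_mono (partialSpaceLE_linSubst_le A d f)).trans
    (Submodule.finrank_map_le _ _)

/-- Lemma 2.20, equality for invertible `A`. [cite: AndrewsForbes2022, Lemma 2.20] -/
theorem finrank_partialSpaceLE_linSubst_eq {σ : Type*} [Fintype σ] [DecidableEq σ]
    (A : Matrix σ σ F) (hA : IsUnit A) (d : ℕ) (f : MvPolynomial σ F) :
    Module.finrank F (partialSpaceLE d (linSubst A f)) = Module.finrank F (partialSpaceLE d f) := by
  refine le_antisymm (finrank_partialSpaceLE_linSubst_le A d f) ?_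
  have hdet : IsUnit A.det := (Matrix.isUnit_iff_isUnit_det A).mp hA
  have h : linSubst A⁻¹ (linSubst A f) = f := by
    rw [← AlgHom.comp_apply, linSubst_comp, Matrix.mul_nonsing_inv A hdet, linSubst_one,
      AlgHom.id_apply]
  conv_lhs => rw [← h]
  exact finrank_partialSpaceLE_linSubst_le A⁻¹ d (linSubst A f)

/-- **Discharge of `AndrewsForbes2022_lemma_2_20`** (Lemma 2.20, p0014:L117), following the printed
proof: by Taylor's formula (`Lemma220.coeff_taylor`, Def. 2.13) and `(f ∘ A)(x + y) = f(Ax + Ay)`,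
every Hasse derivative of order `k` of `f(Ax)` is a linear combination of the polynomials
`(∂^b f)(Ax)` with `|b| = k` (the coefficients being those of `(Ay)^b`), so `∂_{≤d}(f(Ax))` lies in
the image of `∂_{≤d}(f)` under the linear map `g ↦ g(Ax)`; for invertible `A` apply this to `A⁻¹`.
[cite: AndrewsForbes2022, Lemma 2.20] -/
theorem AndrewsForbes2022_lemma_2_20_holds : AndrewsForbes2022_lemma_2_20 := by
  intro F _ n f A d
  exact ⟨finrank_partialSpaceLE_linSubst_le A d f,
    fun hA => finrank_partialSpaceLE_linSubst_eq A hA d f⟩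

end Lemma220Main

end Literature.Computability.AlgebraicComplexity
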